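import Mathlib.NumberTheory.SmoothNumbers
import Mathlib.NumberTheory.EulerProduct.Basic
import Mathlib.NumberTheory.ArithmeticFunction.Misc
import Mathlib.Analysis.SumIntegralComparisons
import Mathlib.Analysis.SpecialFunctions.Pow.Deriv
import Literature.NumberTheory.LFunctions.MoebiusHarmonicSumBound
import Literature.NumberTheory.LFunctions.MontgomeryOffDiagonalTools
import Literature.NumberTheory.LFunctions.MertensElementary
import Literature.NumberTheory.Sieve.GcdQuadraticForm
import Literature.NumberTheory.Sieve.PrimePowersInProgressions
import Literature.NumberTheory.Sieve.SieveFramework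
import Literature.NumberTheory.Sieve.CoprimeMoebiusLogSums
import HarnessLib

/-!
# The plateau mollifier `ψ(s) = ∑_{d ≤ X} μ(d) P(log(X/d)/log X) d^{-s}`, `P(x) = min(1, 2x)`:
# the three quadratic forms of the mollified mean square of `ζ` on the critical line

Topic `Literature/NumberTheory/LFunctions`. Everything in this file is PROVED (definitions with
bodies and theorems; no named facts).

In Selberg's treatment of the zeros of `ζ(s)` near the critical line (A. Selberg,
*Contributions to the theory of the Riemann zeta-function* (1946); Titchmarsh, *The Theory of the
Riemann Zeta-Function*, 2nd ed., §§9.20–9.24, Theorem 9.24 and Theorem 9.19 (C)) the mean square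
`I = ∫_T^{T+U} Z(t)² |ψ(½+it)|² dt` of `ζ` times a Dirichlet polynomial `ψ(s) = ∑_{q ≤ X} b_q q^{-s}`
with real coefficients has, by Titchmarsh's Lemma 9.23 (`∫_T^{T+U} Z² (n/m)^{it} dt =
U (mn)^{-1/2} {log(T/(2πmn)) + 2γ} + O(U^{3/2} T^{-1/2} log T)` for coprime `m, n ≤ X`), the main term
(§9.24, first display after "Using Lemma 9.23")

  `U ∑_{q,r ≤ X} b_q b_r ((q,r)/(qr)) { log(T (q,r)² / (2π q r)) + 2γ }`
  `  = U { (log(T/2π) + 2γ) Q₁ − 2 Q₂ + 2 Q₃ }`,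

  `Q₁ = ∑_{q,r} b_q b_r (q,r)/(qr)`,  `Q₂ = ∑_{q,r} b_q b_r (q,r) log q /(qr)`,
  `Q₃ = ∑_{q,r} b_q b_r (q,r) log (q,r) /(qr)`.

Titchmarsh takes for `b_q` Selberg's `Λ²`-sieve weights, for which `Q₂ = 0` and `Q₁ = 1/G(X)`.
For the zero-density theorem near `σ = 1/2` by the convexity method one needs in addition that
the coefficients of `ζ(s)ψ(s) − 1 = ∑_{n ≥ 2} a_n n^{-s}` vanish for `n ≤ X^{1/2}` (a power saving on
a line `σ > 1`), which forces `b_d = μ(d)` for `d ≤ X^{1/2}`. Both requirements are met by the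
**plateau mollifier** (Levinson–Conrey type weights with the shape `P(x) = min(1, 2x)`):

  `b_d = μ(d) P_X(d)`,  `P_X(d) = max(0, min(1, 2 log(X/d)/log X))`
  (`= 1` for `d ≤ √X`, `= 2 log(X/d)/log X` for `√X ≤ d ≤ X`, `= 0` for `d ≥ X`).

This file proves, with absolute constants, for `X ≥ 3`:

* `Literature.NumberTheory.LFunctions.PlateauMollifier.quadForm_le` — `Q₁ ≤ C₁ / log X`;
* `Literature.NumberTheory.LFunctions.PlateauMollifier.abs_quadForm_log_le` — `|Q₂| ≤ C₂`;
* `Literature.NumberTheory.LFunctions.PlateauMollifier.quadForm_logGcd_le` — `0 ≤ Q₃ ≤ C₃`;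

together with the elementary properties of the weights (`abs_weight_le_one`, `weight_one`,
`weight_eq_moebius` for `d² ≤ X`, `weight_eq_zero` for `d ≥ X`).

## Method (Selberg diagonalisation; Levinson, *More than one third of zeros…*, §§3–4 in spirit)

With `(q,r) = ∑_{l ∣ (q,r)} φ(l)` (and `(q,r) log (q,r) = ∑_{l ∣ (q,r)} w(l)`, `0 ≤ w(l) ≤ 2φ(l) log l`
for squarefree `l`) the forms diagonalise (`Literature.NumberTheory.Sieve.sum_sum_mul_mul_apply_gcd`):
`Q₁ = ∑_l φ(l) y_l²`, `Q₂ = ∑_l φ(l) y_l ỹ_l`, `Q₃ = ∑_l w(l) y_l²` with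
`y_l = ∑_{l ∣ r} b_r/r = (μ(l)/l) ∑_{k ≤ X/l, (k,l)=1} μ(k) P_X(lk)/k` and
`ỹ_l = ∑_{l ∣ q} b_q log q/q = (log l) y_l + (μ(l)/l) W_l`. Abel summation against the monotone
`(2/log X)`-Lipschitz (in `log d`) shape `P_X` gives `|y_l| ≤ (2/(l log X)) ∑_{k ≤ X} |M_l(k)|/k` with the
coprime harmonic Möbius sums `M_l(k) = ∑_{i ≤ k, (i,l)=1} μ(i)/i`, and the identity
`μ · 1_{(·,l)=1} = 1_{l^∞} ⋆ μ` (`1_{l^∞}` the indicator of the integers composed of the primes of `l`)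
gives `M_l(k) = ∑_{m ∣ l^∞, m ≤ k} M(⌊k/m⌋)/m`, whence `∑_{k ≤ X} |M_l(k)|/k ≤ (l/φ(l)) ∑_j |M(j)|/j`,
finite by `M(x) = ∑_{n ≤ x} μ(n)/n ≪ exp(−c√log x)` (tree:
`Literature.NumberTheory.LFunctions.abs_sum_moebius_div_le_exp_neg_sqrt_log`). Hence
`|y_l| ≤ 2K₁/(φ(l) log X)`, `Q₁ ≤ (4K₁²/log²X) ∑_{l ≤ X} 1/φ(l) ≪ 1/log X`
(`Literature.NumberTheory.LFunctions.Montgomery.sum_Icc_inv_totient_le`), `Q₃ ≤ 2 log X · Q₁`, and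
for `Q₂` the same Abel summation for `W_l` with `G_l(k) = ∑_{i ≤ k,(i,l)=1} μ(i) log i/i =
∑_{m ∣ l^∞, m ≤ k} (log m · M(⌊k/m⌋) + G(⌊k/m⌋))/m`, `G(j) = ∑_{i ≤ j} μ(i) log i / i` bounded, gives
`|W_l| ≤ 4 (K₀ ∑_{m ∣ l^∞, m ≤ X} log m/m + K₃ l/φ(l))`; finally
`∑_{m ∣ l^∞} log m / m ≤ (2/e) ∏_{p ∣ l} (1 − p^{-1/2})^{-1}` and
`∑_{l ≤ X, l squarefree} l^{-1} ∏_{p ∣ l}(1 − p^{-1/2})^{-1} ≤ ∏_{p ≤ X} (1 + 1/(p − √p)) ≪ log X`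
(Mertens, tree `Literature.NumberTheory.LFunctions.MertensBound.sum_inv_prime_le`). Only the
*finiteness* of `sup |M|`, `∑ |M(j)|/j`, `sup |G|` is used — no asymptotics for these sums.

## References

* E. C. Titchmarsh, *The Theory of the Riemann Zeta-Function*, 2nd ed. revised by
  D. R. Heath-Brown, Oxford 1986, §9.24 (the main term of `∫ Z²|ψ|²`, the sums
  `∑ δ_q δ_r (q,r)`, `∑ δ_q δ_r (q,r) log q`, `∑ δ_q δ_r (q,r) log (q,r)`), Lemma 9.23, Theorem 9.19 (C).
  [cite: Titchmarsh1986, §9.24]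
* A. Selberg, *Contributions to the theory of the Riemann zeta-function*, Arch. Math. Naturvid. 48
  (1946) no. 5, 89–155.
* N. Levinson, *More than one third of zeros of Riemann's zeta-function are on σ = 1/2*,
  Adv. Math. 13 (1974) 383–436 (mollifiers `μ(d) P(log(X/d)/log X)`).
* B. Conrey, *More than two fifths of the zeros of the Riemann zeta function are on the critical
  line*, J. reine angew. Math. 399 (1989) 1–26 (general shapes `P`).
-/

noncomputable section

open Finset Real ArithmeticFunction
open scoped ArithmeticFunction.Moebius

namespace Literature.NumberTheory.LFunctions.PlateauMollifier

open Literature.NumberTheory.Sieve.CoprimeMoebius (invAF invAF_apply isMultiplicative_invAF)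

/-! ### §1 The harmonic Möbius sums `M(J) = ∑_{j ≤ J} μ(j)/j`, `G(J) = ∑_{j ≤ J} μ(j) log j / j` -/

/-- `M(J) = ∑_{1 ≤ j ≤ J} μ(j)/j`. [folklore] -/
def moebiusInvSum (J : ℕ) : ℝ := ∑ j ∈ Ioc 0 J, (μ j : ℝ) / j

/-- `G(J) = ∑_{1 ≤ j ≤ J} μ(j) log j / j`. [folklore] -/
def moebiusLogSum (J : ℕ) : ℝ := ∑ j ∈ Ioc 0 J, (μ j : ℝ) * Real.log j / j

/-- `M(0) = 0`. [folklore] -/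
theorem moebiusInvSum_zero : moebiusInvSum 0 = 0 := by simp [moebiusInvSum]

/-- `M(1) = 1`. [folklore] -/
theorem moebiusInvSum_one : moebiusInvSum 1 = 1 := by
  simp [moebiusInvSum, show Ioc 0 1 = {1} by rfl]


/-- Discrete Abel summation: `∑_{k=1}^{K} c_k p_k = ∑_{k=1}^{K} C_k (p_k − p_{k+1}) + C_K p_{K+1}`,
`C_k = ∑_{i ≤ k} c_i`. [folklore] -/
theorem sum_Ioc_mul_eq_sum_partial_mul_sub (c p : ℕ → ℝ) (K : ℕ) :
    ∑ k ∈ Ioc 0 K, c k * p k =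
      ∑ k ∈ Ioc 0 K, (∑ i ∈ Ioc 0 k, c i) * (p k - p (k + 1)) +
        (∑ i ∈ Ioc 0 K, c i) * p (K + 1) := by
  induction K with
  | zero => simp
  | succ K ih =>
    rw [Finset.sum_Ioc_succ_top (Nat.zero_le _), ih, Finset.sum_Ioc_succ_top (Nat.zero_le _),
      Finset.sum_Ioc_succ_top (Nat.zero_le _) c]
    ring

/-- Abel's inequality for an antitone weight: `|∑_{k=1}^{K} c_k p_k| ≤ ∑_{k=1}^{K} |C_k| (p_k − p_{k+1})
+ |C_K| |p_{K+1}|`. [folklore] -/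
theorem abs_sum_Ioc_mul_le_of_antitone (c p : ℕ → ℝ) (K : ℕ)
    (hp : ∀ k, p (k + 1) ≤ p k) :
    |∑ k ∈ Ioc 0 K, c k * p k| ≤
      ∑ k ∈ Ioc 0 K, |∑ i ∈ Ioc 0 k, c i| * (p k - p (k + 1)) +
        |∑ i ∈ Ioc 0 K, c i| * |p (K + 1)| := by
  rw [sum_Ioc_mul_eq_sum_partial_mul_sub]
  refine (abs_add_le _ _).trans (add_le_add ((Finset.abs_sum_le_sum_abs _ _).trans
    (Finset.sum_le_sum fun k _ => ?_)) ?_)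
  · rw [abs_mul, abs_of_nonneg (sub_nonneg.2 (hp k))]
  · rw [abs_mul]

/-- An antiderivative of `e^{-c√(log u)}/u` on `(1, ∞)`:
`d/du [ -(2/c²) (c √(log u) + 1) e^{-c √(log u)} ] = e^{-c√(log u)}/u`. [folklore] -/
theorem hasDerivAt_expNegSqrtLog_primitive {c u : ℝ} (hc : 0 < c) (hu : 1 < u) :
    HasDerivAt (fun u : ℝ => -(2 / c ^ 2) * (c * Real.sqrt (Real.log u) + 1) *
        Real.exp (-c * Real.sqrt (Real.log u)))
      (Real.exp (-c * Real.sqrt (Real.log u)) / u) u := by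
  have hu0 : 0 < u := by linarith
  have hlog : 0 < Real.log u := Real.log_pos hu
  have hsq : 0 < Real.sqrt (Real.log u) := Real.sqrt_pos.2 hlog
  -- `v(u) = √(log u)`, `v' = 1/(2 v u)`
  have hv : HasDerivAt (fun u => Real.sqrt (Real.log u))
      (u⁻¹ / (2 * Real.sqrt (Real.log u))) u :=
    (Real.hasDerivAt_log hu0.ne').sqrt hlog.ne'
  set v := Real.sqrt (Real.log u) with hvdef
  set v' := u⁻¹ / (2 * Real.sqrt (Real.log u)) with hv'def
  have hE : HasDerivAt (fun u => Real.exp (-c * Real.sqrt (Real.log u)))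
      (Real.exp (-c * v) * (-c * v')) u := by
    have := (hv.const_mul (-c)).exp
    simpa [mul_comm] using this
  have hA : HasDerivAt (fun u => c * Real.sqrt (Real.log u) + 1) (c * v') u := by
    simpa using (hv.const_mul c).add_const 1
  have hprod := (hA.mul hE).const_mul (-(2 / c ^ 2))
  have key : -(2 / c ^ 2) * (c * v' * Real.exp (-c * v) + (c * v + 1) * (Real.exp (-c * v) * (-c * v')))
      = Real.exp (-c * v) / u := by
    have hvne : v ≠ 0 := hsq.ne'
    rw [hv'def, ← hvdef]
    field_simp
    ring
  rw [← key]
  refine hprod.congr_of_eventuallyEq ?_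
  filter_upwards with w
  simp only [Pi.mul_apply]
  ring

/-- `∑_{2 ≤ j ≤ J} e^{-c√(log j)}/j ≤ 2/c²` (comparison with `∫_1^∞ e^{-c√log u} du/u = 2/c²`).
[folklore] -/
theorem sum_exp_neg_sqrt_log_div_le {c : ℝ} (hc : 0 < c) (J : ℕ) :
    ∑ j ∈ Ioc 1 J, Real.exp (-c * Real.sqrt (Real.log j)) / j ≤ 2 / c ^ 2 := by
  rcases le_or_gt J 1 with hJ | hJ
  · rw [Finset.Ioc_eq_empty (by omega)]; simp; positivity
  set f : ℝ → ℝ := fun u => Real.exp (-c * Real.sqrt (Real.log u)) / u with hf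
  -- antitone on `[1, ∞)`
  have hanti : AntitoneOn f (Set.Icc (1 : ℕ) (J : ℕ)) := by
    intro a ha b hb hab
    simp only [Nat.cast_one, Set.mem_Icc] at ha hb
    simp only [hf]
    have ha0 : 0 < a := by linarith [ha.1]
    have hb0 : 0 < b := by linarith [hb.1]
    have h1 : Real.exp (-c * Real.sqrt (Real.log b)) ≤ Real.exp (-c * Real.sqrt (Real.log a)) := by
      refine Real.exp_le_exp.2 ?_
      have := Real.sqrt_le_sqrt (Real.log_le_log ha0 hab)
      nlinarith
    calc Real.exp (-c * Real.sqrt (Real.log b)) / b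
        ≤ Real.exp (-c * Real.sqrt (Real.log a)) / b :=
          div_le_div_of_nonneg_right h1 hb0.le
      _ ≤ Real.exp (-c * Real.sqrt (Real.log a)) / a :=
          div_le_div_of_nonneg_left (Real.exp_pos _).le ha0 hab
  have hsum := AntitoneOn.sum_le_integral_Ico hJ.le hanti
  -- reindex `∑_{i ∈ Ico 1 J} f(i+1) = ∑_{j ∈ Ioc 1 J} f j`
  have hre : ∑ i ∈ Finset.Ico 1 J, f ((i + 1 : ℕ) : ℝ) = ∑ j ∈ Ioc 1 J, f j := by
    rw [Finset.sum_Ico_add' (fun j : ℕ => f (j : ℝ)) 1 J 1]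
    congr 1
  -- the integral
  set F : ℝ → ℝ := fun u => -(2 / c ^ 2) * (c * Real.sqrt (Real.log u) + 1) *
    Real.exp (-c * Real.sqrt (Real.log u)) with hF
  have hJ1 : (1 : ℝ) ≤ J := by exact_mod_cast hJ.le
  have hcont : ContinuousOn F (Set.Icc 1 J) := by
    have : ContinuousOn (fun u : ℝ => Real.sqrt (Real.log u)) (Set.Icc 1 J) :=
      Real.continuous_sqrt.comp_continuousOn
        (Real.continuousOn_log.mono fun u hu => by
          simp only [Set.mem_Icc] at hu; exact ne_of_gt (by linarith [hu.1]))
    simp only [hF]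
    fun_prop
  have hderiv : ∀ u ∈ Set.Ioo (1 : ℝ) J, HasDerivAt F (f u) u := fun u hu =>
    hasDerivAt_expNegSqrtLog_primitive hc hu.1
  have hfcont : ContinuousOn f (Set.Icc 1 J) := by
    have : ContinuousOn (fun u : ℝ => Real.sqrt (Real.log u)) (Set.Icc 1 J) :=
      Real.continuous_sqrt.comp_continuousOn
        (Real.continuousOn_log.mono fun u hu => by
          simp only [Set.mem_Icc] at hu; exact ne_of_gt (by linarith [hu.1]))
    simp only [hf]
    refine ContinuousOn.div (by fun_prop) continuousOn_id fun u hu => ?_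
    simp only [Set.mem_Icc] at hu; exact ne_of_gt (by simpa using (by linarith [hu.1] : (0:ℝ) < u))
  have hint : IntervalIntegrable f MeasureTheory.volume 1 J :=
    (hfcont.mono (by rw [Set.uIcc_of_le hJ1])).intervalIntegrable
  have hftc := intervalIntegral.integral_eq_sub_of_hasDerivAt_of_le hJ1 hcont hderiv hint
  have hFJ : F J ≤ 0 := by
    simp only [hF]
    have : 0 ≤ c * Real.sqrt (Real.log J) + 1 := by positivity
    have h2 : 0 ≤ 2 / c ^ 2 := by positivity
    nlinarith [Real.exp_pos (-c * Real.sqrt (Real.log J)), mul_nonneg h2 this]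
  have hF1 : F 1 = -(2 / c ^ 2) := by simp [hF]
  calc ∑ j ∈ Ioc 1 J, Real.exp (-c * Real.sqrt (Real.log j)) / j
      = ∑ i ∈ Finset.Ico 1 J, f ((i + 1 : ℕ) : ℝ) := hre.symm
    _ ≤ ∫ u in (1 : ℕ)..(J : ℕ), f u := hsum
    _ = F J - F 1 := by simpa using hftc
    _ ≤ 2 / c ^ 2 := by rw [hF1]; linarith

/-- `M(J)` agrees with the tree's `∑_{k ∈ Icc 1 ⌊J⌋} μ(k)/k`. [folklore] -/
theorem moebiusInvSum_eq_sum_Icc_floor (J : ℕ) :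
    moebiusInvSum J = ∑ k ∈ Icc 1 ⌊(J : ℝ)⌋₊, (μ k : ℝ) / k := by
  rw [moebiusInvSum, Nat.floor_natCast, ← Finset.Icc_add_one_left_eq_Ioc]
  rfl

/-- `v e^{-c√v} ≤ 2/c²` for `v ≥ 0` (from `e^x ≥ x²/2`). [folklore] -/
theorem mul_exp_neg_sqrt_le {c v : ℝ} (hc : 0 < c) (hv : 0 ≤ v) :
    v * Real.exp (-c * Real.sqrt v) ≤ 2 / c ^ 2 := by
  have hx : 0 ≤ c * Real.sqrt v := by positivity
  have h1 := Real.quadratic_le_exp_of_nonneg hx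
  have h2 : (c * Real.sqrt v) ^ 2 = c ^ 2 * v := by
    rw [mul_pow, Real.sq_sqrt hv]
  have h3 : c ^ 2 * v / 2 ≤ Real.exp (c * Real.sqrt v) := by nlinarith
  have h4 : Real.exp (-c * Real.sqrt v) = (Real.exp (c * Real.sqrt v))⁻¹ := by
    rw [← Real.exp_neg]; ring_nf
  rw [h4, ← div_eq_mul_inv, div_le_div_iff₀ (Real.exp_pos _) (by positivity)]
  nlinarith

/-- **Finiteness of the harmonic Möbius sums.** There are constants `K₀, K₁, K₃ ≥ 1` with
`|M(J)| ≤ K₀`, `|M(J)| log J ≤ K₀`, `∑_{j ≤ J} |M(j)|/j ≤ K₁` and `|G(J)| ≤ K₃` for all `J`, where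
`M(J) = ∑_{j ≤ J} μ(j)/j`, `G(J) = ∑_{j ≤ J} μ(j) log j/j`. From the tree's
`M(x) ≪ exp(−c√log x)` (`Literature.NumberTheory.LFunctions.abs_sum_moebius_div_le_exp_neg_sqrt_log`),
`∑_{j ≥ 2} e^{-c√log j}/j ≤ 2/c²`, and Abel summation `G(J) = M(J) log(J+1) − ∑_{j ≤ J} M(j) log(1 + 1/j)`.
[cite: MontgomeryVaughan2007, Theorem 6.9 (6.12) and §8.1 (8.6)] -/
theorem exists_moebius_bounds : ∃ K₀ K₁ K₃ : ℝ, 1 ≤ K₀ ∧ 1 ≤ K₁ ∧ 1 ≤ K₃ ∧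
    (∀ J, |moebiusInvSum J| ≤ K₀) ∧ (∀ J, |moebiusInvSum J| * Real.log J ≤ K₀) ∧
    (∀ J, ∑ j ∈ Ioc 0 J, |moebiusInvSum j| / j ≤ K₁) ∧ (∀ J, |moebiusLogSum J| ≤ K₃) := by
  obtain ⟨c, hc, C, hM⟩ := abs_sum_moebius_div_le_exp_neg_sqrt_log
  set C' : ℝ := max C 0 with hC'
  have hC'0 : 0 ≤ C' := le_max_right _ _
  -- the basic pointwise bound for `J ≥ 2`
  have hMJ : ∀ J : ℕ, 2 ≤ J → |moebiusInvSum J| ≤ C' * Real.exp (-c * Real.sqrt (Real.log J)) := by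
    intro J hJ
    rw [moebiusInvSum_eq_sum_Icc_floor]
    refine (hM J (by exact_mod_cast hJ)).trans ?_
    exact mul_le_mul_of_nonneg_right (le_max_left _ _) (Real.exp_pos _).le
  have hexp1 : ∀ J : ℕ, Real.exp (-c * Real.sqrt (Real.log J)) ≤ 1 := fun J => by
    rw [Real.exp_le_one_iff]; nlinarith [Real.sqrt_nonneg (Real.log J)]
  -- small `J`
  have hM0 : ∀ J : ℕ, J < 2 → |moebiusInvSum J| ≤ 1 := by
    intro J hJ
    interval_cases J
    · rw [moebiusInvSum_zero, abs_zero]; exact zero_le_one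
    · rw [moebiusInvSum_one, abs_one]
  set K₀ : ℝ := 1 + C' + 2 * C' / c ^ 2 with hK₀
  have hK₀1 : 1 ≤ K₀ := by
    rw [hK₀]; have : 0 ≤ 2 * C' / c ^ 2 := by positivity
    linarith
  have hA : ∀ J, |moebiusInvSum J| ≤ K₀ := by
    intro J
    rcases lt_or_ge J 2 with hJ | hJ
    · exact (hM0 J hJ).trans hK₀1
    · calc |moebiusInvSum J| ≤ C' * Real.exp (-c * Real.sqrt (Real.log J)) := hMJ J hJ
        _ ≤ C' * 1 := mul_le_mul_of_nonneg_left (hexp1 J) hC'0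
        _ ≤ K₀ := by
            rw [hK₀, mul_one]; have : 0 ≤ 2 * C' / c ^ 2 := by positivity
            linarith
  have hB : ∀ J, |moebiusInvSum J| * Real.log J ≤ K₀ := by
    intro J
    rcases lt_or_ge J 2 with hJ | hJ
    · interval_cases J <;> simp [moebiusInvSum_zero, moebiusInvSum_one] <;> linarith
    · have hlog : 0 ≤ Real.log J := Real.log_nonneg (by exact_mod_cast (by omega : 1 ≤ J))
      calc |moebiusInvSum J| * Real.log J
          ≤ C' * Real.exp (-c * Real.sqrt (Real.log J)) * Real.log J :=
            mul_le_mul_of_nonneg_right (hMJ J hJ) hlog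
        _ = C' * (Real.log J * Real.exp (-c * Real.sqrt (Real.log J))) := by ring
        _ ≤ C' * (2 / c ^ 2) := mul_le_mul_of_nonneg_left (mul_exp_neg_sqrt_le hc hlog) hC'0
        _ ≤ K₀ := by
            rw [hK₀]; have : C' * (2 / c ^ 2) = 2 * C' / c ^ 2 := by ring
            linarith
  set K₁ : ℝ := 1 + C' * (2 / c ^ 2) with hK₁
  have hK₁1 : 1 ≤ K₁ := by
    rw [hK₁]; have : 0 ≤ C' * (2 / c ^ 2) := by positivity
    linarith
  have hCsum : ∀ J, ∑ j ∈ Ioc 0 J, |moebiusInvSum j| / j ≤ K₁ := by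
    intro J
    rcases Nat.eq_zero_or_pos J with rfl | hJ
    · simp; linarith
    have hsplit : ∑ j ∈ Ioc 0 J, |moebiusInvSum j| / j =
        |moebiusInvSum 1| / 1 + ∑ j ∈ Ioc 1 J, |moebiusInvSum j| / j := by
      have h1 : Ioc 0 J = insert 1 (Ioc 1 J) := by ext j; simp; omega
      rw [h1, Finset.sum_insert (by simp)]
      simp
    rw [hsplit, moebiusInvSum_one, abs_one, div_one, hK₁]
    refine add_le_add le_rfl ?_
    calc ∑ j ∈ Ioc 1 J, |moebiusInvSum j| / j
        ≤ ∑ j ∈ Ioc 1 J, C' * (Real.exp (-c * Real.sqrt (Real.log j)) / j) := by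
          refine Finset.sum_le_sum fun j hj => ?_
          have hj2 : 2 ≤ j := by have := (Finset.mem_Ioc.1 hj).1; omega
          rw [mul_div_assoc']
          exact div_le_div_of_nonneg_right (hMJ j hj2) (Nat.cast_nonneg j)
      _ = C' * ∑ j ∈ Ioc 1 J, Real.exp (-c * Real.sqrt (Real.log j)) / j := by
          rw [Finset.mul_sum]
      _ ≤ C' * (2 / c ^ 2) :=
          mul_le_mul_of_nonneg_left (sum_exp_neg_sqrt_log_div_le hc J) hC'0
  -- `G` by Abel summation with the increasing weight `log`
  set K₃ : ℝ := K₁ + 2 * K₀ with hK₃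
  refine ⟨K₀, K₁, K₃, hK₀1, hK₁1, by rw [hK₃]; linarith, hA, hB, hCsum, fun J => ?_⟩
  have habel := sum_Ioc_mul_eq_sum_partial_mul_sub (fun j => (μ j : ℝ) / j)
    (fun j => Real.log j) J
  have hG : moebiusLogSum J = ∑ k ∈ Ioc 0 J, (μ k : ℝ) / k * Real.log k := by
    rw [moebiusLogSum]
    refine Finset.sum_congr rfl fun k hk => ?_
    ring
  rw [hG, habel]
  have hMk : ∀ k, ∑ i ∈ Ioc 0 k, (μ i : ℝ) / i = moebiusInvSum k := fun k => rfl
  simp only [hMk]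
  have hlogdiff : ∀ k : ℕ, 0 < k → |Real.log k - Real.log ((k + 1 : ℕ) : ℝ)| ≤ 1 / k := by
    intro k hk
    have hk0 : (0 : ℝ) < k := by exact_mod_cast hk
    have h1 : Real.log ((k + 1 : ℕ) : ℝ) - Real.log k = Real.log (1 + 1 / k) := by
      rw [← Real.log_div (by positivity) hk0.ne']
      congr 1
      push_cast
      field_simp
    have h2 : 0 ≤ Real.log (1 + 1 / k) := Real.log_nonneg (by
      have : (0:ℝ) ≤ 1 / k := by positivity
      linarith)
    have h3 : Real.log (1 + 1 / k) ≤ 1 / k := by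
      have := Real.log_le_sub_one_of_pos (show (0:ℝ) < 1 + 1 / k by positivity)
      linarith
    rw [abs_sub_comm, h1, abs_of_nonneg h2]
    exact h3
  have hterm : ∀ k ∈ Ioc 0 J,
      |moebiusInvSum k * (Real.log k - Real.log ((k + 1 : ℕ) : ℝ))| ≤ |moebiusInvSum k| / k := by
    intro k hk
    have hk0 : 0 < k := (Finset.mem_Ioc.1 hk).1
    rw [abs_mul, div_eq_mul_one_div]
    exact mul_le_mul_of_nonneg_left (hlogdiff k hk0) (abs_nonneg _)
  have hlast : |moebiusInvSum J * Real.log ((J + 1 : ℕ) : ℝ)| ≤ 2 * K₀ := by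
    rcases Nat.eq_zero_or_pos J with rfl | hJ
    · rw [moebiusInvSum_zero, zero_mul, abs_zero]; linarith
    have hJ0 : (0 : ℝ) < J := by exact_mod_cast hJ
    have hlogJ1 : Real.log ((J + 1 : ℕ) : ℝ) ≤ Real.log J + 1 := by
      have := hlogdiff J hJ
      have h1J : (1 : ℝ) / J ≤ 1 := by
        rw [div_le_one hJ0]; exact_mod_cast hJ
      linarith [(abs_le.1 this).1]
    have hlog0 : 0 ≤ Real.log ((J + 1 : ℕ) : ℝ) := Real.log_nonneg (by
      have : (1:ℝ) ≤ (J + 1 : ℕ) := by exact_mod_cast Nat.le_add_left 1 J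
      exact this)
    rw [abs_mul, abs_of_nonneg hlog0]
    calc |moebiusInvSum J| * Real.log ((J + 1 : ℕ) : ℝ)
        ≤ |moebiusInvSum J| * (Real.log J + 1) :=
          mul_le_mul_of_nonneg_left hlogJ1 (abs_nonneg _)
      _ = |moebiusInvSum J| * Real.log J + |moebiusInvSum J| := by ring
      _ ≤ K₀ + K₀ := add_le_add (hB J) (hA J)
      _ = 2 * K₀ := by ring
  calc |∑ k ∈ Ioc 0 J, moebiusInvSum k * (Real.log k - Real.log ((k + 1 : ℕ) : ℝ)) +
          moebiusInvSum J * Real.log ((J + 1 : ℕ) : ℝ)|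
      ≤ ∑ k ∈ Ioc 0 J, |moebiusInvSum k * (Real.log k - Real.log ((k + 1 : ℕ) : ℝ))| +
          |moebiusInvSum J * Real.log ((J + 1 : ℕ) : ℝ)| :=
        (abs_add_le _ _).trans (add_le_add (Finset.abs_sum_le_sum_abs _ _) le_rfl)
    _ ≤ ∑ k ∈ Ioc 0 J, |moebiusInvSum k| / k + 2 * K₀ :=
        add_le_add (Finset.sum_le_sum hterm) hlast
    _ ≤ K₁ + 2 * K₀ := add_le_add (hCsum J) le_rfl
    _ = K₃ := by rw [hK₃]

/-! ### §2 Coprime harmonic Möbius sums: `μ · 1_{(·,l)=1} = 1_{l^∞} ⋆ μ` -/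

/-- `n ↦ μ(n)/n`. [folklore] -/
def moebiusInvAF : ArithmeticFunction ℝ := ⟨fun n => (μ n : ℝ) / n, by simp⟩

/-- `n ↦ μ(n)/n` restricted to `(n, l) = 1`. [folklore] -/
def coprimeMoebiusInvAF (l : ℕ) : ArithmeticFunction ℝ :=
  ⟨fun n => if n.Coprime l then (μ n : ℝ) / n else 0, by simp⟩

/-- `1_{l^∞}(m)/m`: `1/m` if every prime factor of `m` divides `l` (`m ∣ l^∞`), else `0`. [folklore] -/
def factoredInvAF (l : ℕ) : ArithmeticFunction ℝ :=
  ⟨fun m => if m ≠ 0 ∧ m.primeFactors ⊆ l.primeFactors then (m : ℝ)⁻¹ else 0, by simp⟩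

/-- Unfolding. [folklore] -/
@[simp] theorem moebiusInvAF_apply (n : ℕ) : moebiusInvAF n = (μ n : ℝ) / n := rfl
/-- Unfolding. [folklore] -/
@[simp] theorem coprimeMoebiusInvAF_apply (l n : ℕ) :
    coprimeMoebiusInvAF l n = if n.Coprime l then (μ n : ℝ) / n else 0 := rfl
/-- Unfolding. [folklore] -/
@[simp] theorem factoredInvAF_apply (l m : ℕ) :
    factoredInvAF l m = if m ≠ 0 ∧ m.primeFactors ⊆ l.primeFactors then (m : ℝ)⁻¹ else 0 := rfl

/-- `1_{l^∞}(m)/m ≥ 0`. [folklore] -/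
theorem factoredInvAF_nonneg (l m : ℕ) : 0 ≤ factoredInvAF l m := by
  rw [factoredInvAF_apply]; split_ifs <;> positivity

/-- `μ/·` is multiplicative. [folklore] -/
theorem isMultiplicative_moebiusInvAF : moebiusInvAF.IsMultiplicative := by
  refine ⟨by simp, fun {m n} hmn => ?_⟩
  simp only [moebiusInvAF_apply, Nat.cast_mul,
    ArithmeticFunction.isMultiplicative_moebius.map_mul_of_coprime hmn, Int.cast_mul]
  rw [div_mul_div_comm]

/-- `μ 1_{(·,l)=1}/·` is multiplicative. [folklore] -/
theorem isMultiplicative_coprimeMoebiusInvAF (l : ℕ) : (coprimeMoebiusInvAF l).IsMultiplicative := by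
  refine ⟨by simp, fun {m n} hmn => ?_⟩
  simp only [coprimeMoebiusInvAF_apply]
  by_cases hm : m.Coprime l <;> by_cases hn : n.Coprime l
  · rw [if_pos (Nat.Coprime.mul_left hm hn), if_pos hm, if_pos hn, Nat.cast_mul,
      ArithmeticFunction.isMultiplicative_moebius.map_mul_of_coprime hmn, Int.cast_mul,
      div_mul_div_comm]
  · rw [if_neg (fun h => hn (Nat.Coprime.coprime_mul_left h)), if_neg hn, mul_zero]
  · rw [if_neg (fun h => hm (Nat.Coprime.coprime_mul_right h)), if_neg hm, zero_mul]
  · rw [if_neg (fun h => hm (Nat.Coprime.coprime_mul_right h)), if_neg hm, zero_mul]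

/-- `1_{l^∞}/·` is multiplicative. [folklore] -/
theorem isMultiplicative_factoredInvAF (l : ℕ) : (factoredInvAF l).IsMultiplicative := by
  refine ⟨by simp, fun {m n} hmn => ?_⟩
  simp only [factoredInvAF_apply]
  rcases Nat.eq_zero_or_pos m with rfl | hm
  · simp
  rcases Nat.eq_zero_or_pos n with rfl | hn
  · simp
  have hm0 : m ≠ 0 := hm.ne'
  have hn0 : n ≠ 0 := hn.ne'
  have hmn0 : m * n ≠ 0 := mul_ne_zero hm0 hn0
  simp only [Nat.primeFactors_mul hm0 hn0, Finset.union_subset_iff]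
  by_cases h1 : m.primeFactors ⊆ l.primeFactors <;> by_cases h2 : n.primeFactors ⊆ l.primeFactors <;>
    simp [h1, h2, hm0, hn0, mul_comm]

/-- `(1/·) ⋆ (μ/·) = δ`. [folklore] -/
theorem invAF_mul_moebiusInvAF : invAF * moebiusInvAF = 1 := by
  rw [ArithmeticFunction.IsMultiplicative.eq_iff_eq_on_prime_powers _
    (isMultiplicative_invAF.mul isMultiplicative_moebiusInvAF) 1
    ArithmeticFunction.isMultiplicative_one]
  intro p i hp
  rcases Nat.eq_zero_or_pos i with rfl | hi
  · simp [isMultiplicative_invAF.mul isMultiplicative_moebiusInvAF |>.map_one]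
  obtain ⟨n, rfl⟩ : ∃ n, i = n + 1 := ⟨i - 1, by omega⟩
  have hp0 : 0 < p := hp.pos
  have hpR : (p : ℝ) ≠ 0 := by exact_mod_cast hp.ne_zero
  rw [ArithmeticFunction.one_apply_ne (by
      exact (Nat.one_lt_pow (by omega) hp.one_lt).ne'), ArithmeticFunction.mul_apply,
    Nat.sum_divisorsAntidiagonal' (fun a b => invAF a * moebiusInvAF b),
    Nat.sum_divisors_prime_pow hp, Finset.sum_range_succ', Finset.sum_range_succ']
  have hrest : ∑ x ∈ Finset.range n,
      invAF (p ^ (n + 1) / p ^ (x + 1 + 1)) * moebiusInvAF (p ^ (x + 1 + 1)) = 0 := by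
    refine Finset.sum_eq_zero fun x _ => ?_
    rw [moebiusInvAF_apply, ArithmeticFunction.moebius_apply_prime_pow hp (by omega), if_neg (by omega)]
    simp
  have hdiv : p ^ (n + 1) / p = p ^ n := by rw [pow_succ, Nat.mul_div_cancel _ hp0]
  rw [hrest, zero_add, pow_zero, Nat.div_one, pow_one, hdiv]
  simp only [invAF_apply, moebiusInvAF_apply, ArithmeticFunction.moebius_apply_prime hp,
    ArithmeticFunction.moebius_apply_one, Int.cast_neg, Int.cast_one, Nat.cast_pow, Nat.cast_one,
    div_one]
  rw [pow_succ]
  field_simp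
  ring

/-- `1_{l^∞}/· = (μ 1_{(·,l)=1}/·) ⋆ (1/·)` for `l ≠ 0` (both sides are multiplicative; at `p^i`,
`i ≥ 1`, both equal `[p ∣ l] p^{-i}`). [folklore] -/
theorem factoredInvAF_eq_mul {l : ℕ} (hl : l ≠ 0) :
    factoredInvAF l = coprimeMoebiusInvAF l * invAF := by
  rw [ArithmeticFunction.IsMultiplicative.eq_iff_eq_on_prime_powers _ (isMultiplicative_factoredInvAF l) _
    ((isMultiplicative_coprimeMoebiusInvAF l).mul isMultiplicative_invAF)]
  intro p i hp
  rcases Nat.eq_zero_or_pos i with rfl | hi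
  · rw [pow_zero, (isMultiplicative_factoredInvAF l).map_one,
      ((isMultiplicative_coprimeMoebiusInvAF l).mul isMultiplicative_invAF).map_one]
  obtain ⟨n, rfl⟩ : ∃ n, i = n + 1 := ⟨i - 1, by omega⟩
  have hp0 : 0 < p := hp.pos
  have hpR : (p : ℝ) ≠ 0 := by exact_mod_cast hp.ne_zero
  rw [ArithmeticFunction.mul_apply,
    Nat.sum_divisorsAntidiagonal (fun a b => coprimeMoebiusInvAF l a * invAF b),
    Nat.sum_divisors_prime_pow hp, Finset.sum_range_succ', Finset.sum_range_succ']
  have hrest : ∑ x ∈ Finset.range n,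
      coprimeMoebiusInvAF l (p ^ (x + 1 + 1)) * invAF (p ^ (n + 1) / p ^ (x + 1 + 1)) = 0 := by
    refine Finset.sum_eq_zero fun x _ => ?_
    rw [coprimeMoebiusInvAF_apply, ArithmeticFunction.moebius_apply_prime_pow hp (by omega),
      if_neg (show x + 1 + 1 ≠ 1 by omega)]
    simp
  have hdiv : p ^ (n + 1) / p = p ^ n := by rw [pow_succ, Nat.mul_div_cancel _ hp0]
  rw [hrest, zero_add, pow_zero, Nat.div_one, pow_one, hdiv]
  have hpf : (p ^ (n + 1)).primeFactors = {p} := Nat.primeFactors_prime_pow (by omega) hp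
  have hpl : ({p} : Finset ℕ) ⊆ l.primeFactors ↔ p ∣ l := by
    rw [Finset.singleton_subset_iff, Nat.mem_primeFactors]
    exact ⟨fun h => h.2.1, fun h => ⟨hp, h, hl⟩⟩
  have hpn0 : p ^ (n + 1) ≠ 0 := pow_ne_zero _ hp.ne_zero
  simp only [factoredInvAF_apply, coprimeMoebiusInvAF_apply, invAF_apply, hpf,
    ArithmeticFunction.moebius_apply_prime hp, ArithmeticFunction.moebius_apply_one, Nat.coprime_one_left_iff,
    if_true, Int.cast_one, Nat.cast_one, div_one, Int.cast_neg, Nat.cast_pow,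
    Nat.Prime.coprime_iff_not_dvd hp]
  by_cases hdiv : p ∣ l
  · rw [if_pos ⟨hpn0, hpl.2 hdiv⟩, if_neg (not_not.2 hdiv)]
    simp
  · rw [if_neg (fun h => hdiv (hpl.1 h.2)), if_pos hdiv, pow_succ]
    field_simp
    ring

/-- `μ 1_{(·,l)=1}/· = (1_{l^∞}/·) ⋆ (μ/·)` for `l ≠ 0`. [folklore] -/
theorem coprimeMoebiusInvAF_eq_mul {l : ℕ} (hl : l ≠ 0) :
    coprimeMoebiusInvAF l = factoredInvAF l * moebiusInvAF := by
  rw [factoredInvAF_eq_mul hl, mul_assoc, invAF_mul_moebiusInvAF, mul_one]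

/-- Leibniz rule for the pointwise weight `log`: `(f ⋆ g)·log = (f·log) ⋆ g + f ⋆ (g·log)`.
[folklore] -/
theorem pmul_log_mul (f g : ArithmeticFunction ℝ) :
    (f * g).pmul ArithmeticFunction.log = f.pmul ArithmeticFunction.log * g + f * g.pmul ArithmeticFunction.log := by
  ext n
  simp only [ArithmeticFunction.pmul_apply, ArithmeticFunction.add_apply, ArithmeticFunction.mul_apply,
    ArithmeticFunction.log_apply, Finset.sum_mul, ← Finset.sum_add_distrib]
  refine Finset.sum_congr rfl fun x hx => ?_
  obtain ⟨hxn, hn⟩ := Nat.mem_divisorsAntidiagonal.1 hx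
  have hx1 : x.1 ≠ 0 := fun h => hn (by rw [← hxn, h, zero_mul])
  have hx2 : x.2 ≠ 0 := fun h => hn (by rw [← hxn, h, mul_zero])
  rw [← hxn, Nat.cast_mul, Real.log_mul (by exact_mod_cast hx1) (by exact_mod_cast hx2)]
  ring

/-- **`M_l(k) = ∑_{m ∣ l^∞, m ≤ k} M(⌊k/m⌋)/m`**: the coprime harmonic Möbius sum in terms of the
full ones. [folklore] -/
theorem sum_coprimeMoebiusInv_eq {l : ℕ} (hl : l ≠ 0) (k : ℕ) :
    ∑ i ∈ Ioc 0 k, coprimeMoebiusInvAF l i =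
      ∑ m ∈ Ioc 0 k, factoredInvAF l m * moebiusInvSum (k / m) := by
  rw [coprimeMoebiusInvAF_eq_mul hl, ArithmeticFunction.sum_Ioc_mul_eq_sum_sum]
  rfl

/-- **`G_l(k) = ∑_{m ∣ l^∞, m ≤ k} (log m · M(⌊k/m⌋) + G(⌊k/m⌋))/m`**. [folklore] -/
theorem sum_coprimeMoebiusInv_mul_log_eq {l : ℕ} (hl : l ≠ 0) (k : ℕ) :
    ∑ i ∈ Ioc 0 k, coprimeMoebiusInvAF l i * Real.log i =
      ∑ m ∈ Ioc 0 k, factoredInvAF l m * Real.log m * moebiusInvSum (k / m) +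
        ∑ m ∈ Ioc 0 k, factoredInvAF l m * moebiusLogSum (k / m) := by
  have h1 : ∀ i, coprimeMoebiusInvAF l i * Real.log i =
      ((factoredInvAF l * moebiusInvAF).pmul ArithmeticFunction.log) i := by
    intro i
    rw [← coprimeMoebiusInvAF_eq_mul hl, ArithmeticFunction.pmul_apply, ArithmeticFunction.log_apply]
  simp_rw [h1, pmul_log_mul, ArithmeticFunction.add_apply, Finset.sum_add_distrib,
    ArithmeticFunction.sum_Ioc_mul_eq_sum_sum]
  congr 1
  refine Finset.sum_congr rfl fun m _ => ?_
  refine congrArg (factoredInvAF l m * ·) ?_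
  rw [moebiusLogSum]
  refine Finset.sum_congr rfl fun j _ => ?_
  rw [ArithmeticFunction.pmul_apply, ArithmeticFunction.log_apply, moebiusInvAF_apply]
  ring

/-! ### §3 Euler products over the primes of `l`: `∑_{m ∣ l^∞} m^{-s} ≤ ∏_{p ∣ l} (1 − p^{-s})⁻¹` -/

/-- `∑_{m ≤ N, m ∣ l^∞} m^{-s} ≤ ∏_{p ∣ l} (1 − p^{-s})⁻¹` (`s > 0`): a finite part of the Euler
product over the primes dividing `l` (Mathlib's
`EulerProduct.summable_and_hasSum_factoredNumbers_prod_filter_prime_geometric`). [folklore] -/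
theorem sum_factored_rpow_le {s : ℝ} (hs : 0 < s) (l N : ℕ) :
    ∑ m ∈ Ioc 0 N, (if m ≠ 0 ∧ m.primeFactors ⊆ l.primeFactors then (m : ℝ) ^ (-s) else 0) ≤
      ∏ p ∈ l.primeFactors, (1 - (p : ℝ) ^ (-s))⁻¹ := by
  classical
  set T := l.primeFactors with hT
  let f : ℕ →* ℝ :=
    { toFun := fun n => (n : ℝ) ^ (-s)
      map_one' := by simp
      map_mul' := fun a b => by
        simp only [Nat.cast_mul]
        exact Real.mul_rpow (Nat.cast_nonneg a) (Nat.cast_nonneg b) }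
  have hfapp : ∀ n : ℕ, f n = (n : ℝ) ^ (-s) := fun n => rfl
  have hf : ∀ {p : ℕ}, p.Prime → ‖f p‖ < 1 := by
    intro p hp
    rw [hfapp, Real.norm_eq_abs, abs_of_nonneg (Real.rpow_nonneg (Nat.cast_nonneg p) _)]
    exact Real.rpow_lt_one_of_one_lt_of_neg (by exact_mod_cast hp.one_lt) (by linarith)
  obtain ⟨-, hsum⟩ := EulerProduct.summable_and_hasSum_factoredNumbers_prod_filter_prime_geometric hf T
  rw [Finset.filter_true_of_mem (fun p hp => Nat.prime_of_mem_primeFactors hp)] at hsum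
  set A := (Ioc 0 N).filter (fun m => m ≠ 0 ∧ m.primeFactors ⊆ T) with hA
  have hAmem : ∀ m ∈ A, m ∈ Nat.factoredNumbers T := fun m hm =>
    Nat.mem_factoredNumbers_iff_primeFactors_subset.2 (Finset.mem_filter.1 hm).2
  have h1 : ∑ m ∈ Ioc 0 N, (if m ≠ 0 ∧ m.primeFactors ⊆ l.primeFactors then (m : ℝ) ^ (-s) else 0)
      = ∑ m ∈ A, f m := by
    rw [hA, Finset.sum_filter]
    rfl
  have h2 : ∑ m ∈ A, f m = ∑ x ∈ A.subtype (· ∈ Nat.factoredNumbers T), f x := by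
    rw [Finset.sum_subtype_eq_sum_filter]
    conv_lhs => rw [← Finset.filter_true_of_mem hAmem]
  rw [h1, h2]
  simp only [hfapp] at hsum ⊢
  exact sum_le_hasSum _ (fun x _ => Real.rpow_nonneg (Nat.cast_nonneg _) _) hsum

/-- `∏_{p ∣ l} (1 − 1/p)⁻¹ = l/φ(l)` for `l ≠ 0` (Euler's product for `φ`). [folklore] -/
theorem prod_primeFactors_one_sub_inv_inv {l : ℕ} (hl : l ≠ 0) :
    ∏ p ∈ l.primeFactors, (1 - (p : ℝ)⁻¹)⁻¹ = (l : ℝ) / Nat.totient l := by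
  have h := congrArg (fun q : ℚ => (q : ℝ)) (Nat.totient_eq_mul_prod_factors l)
  simp only [Rat.cast_natCast, Rat.cast_mul, Rat.cast_prod, Rat.cast_sub, Rat.cast_one,
    Rat.cast_inv] at h
  have hl0 : (l : ℝ) ≠ 0 := by exact_mod_cast hl
  have hφ : (Nat.totient l : ℝ) ≠ 0 := by exact_mod_cast (Nat.totient_pos.2 (Nat.pos_of_ne_zero hl)).ne'
  have hP : ∏ p ∈ l.primeFactors, (1 - (p : ℝ)⁻¹) ≠ 0 := by
    intro h0; rw [h0, mul_zero] at h; exact hφ h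
  rw [Finset.prod_inv_distrib, eq_div_iff hφ, h, mul_comm, mul_assoc, mul_inv_cancel₀ hP, mul_one]

/-- `∑_{m ≤ N, m ∣ l^∞} 1/m ≤ l/φ(l)`. [folklore] -/
theorem sum_factoredInvAF_le {l : ℕ} (hl : l ≠ 0) (N : ℕ) :
    ∑ m ∈ Ioc 0 N, factoredInvAF l m ≤ (l : ℝ) / Nat.totient l := by
  have h := sum_factored_rpow_le one_pos l N
  simp only [Real.rpow_neg_one] at h
  rw [prod_primeFactors_one_sub_inv_inv hl] at h
  refine le_trans (le_of_eq (Finset.sum_congr rfl fun m _ => ?_)) h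
  rw [factoredInvAF_apply]

/-- `F(l) = ∏_{p ∣ l} (1 − p^{-1/2})⁻¹`, the Euler product bounding `∑_{m ∣ l^∞} m^{-1/2}`. [folklore] -/
def sqrtEulerFactor (l : ℕ) : ℝ := ∏ p ∈ l.primeFactors, (1 - (p : ℝ) ^ (-(1 / 2 : ℝ)))⁻¹

/-- `1 − p^{-1/2} > 0` for a prime `p`. [folklore] -/
theorem one_sub_rpow_neg_half_pos {p : ℕ} (hp : p.Prime) : 0 < 1 - (p : ℝ) ^ (-(1 / 2 : ℝ)) := by
  have := Real.rpow_lt_one_of_one_lt_of_neg (x := (p : ℝ)) (by exact_mod_cast hp.one_lt)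
    (by norm_num : -(1 / 2 : ℝ) < 0)
  linarith

/-- `F(l) > 0`. [folklore] -/
theorem sqrtEulerFactor_pos (l : ℕ) : 0 < sqrtEulerFactor l :=
  Finset.prod_pos fun _ hp => inv_pos.2 (one_sub_rpow_neg_half_pos (Nat.prime_of_mem_primeFactors hp))

/-- `F(l) ≥ 1`. [folklore] -/
theorem one_le_sqrtEulerFactor (l : ℕ) : 1 ≤ sqrtEulerFactor l := by
  rw [sqrtEulerFactor]
  calc (1 : ℝ) = ∏ _p ∈ l.primeFactors, (1 : ℝ) := by simp
    _ ≤ _ := by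
      refine Finset.prod_le_prod (fun _ _ => zero_le_one) fun p hp => ?_
      have h1 := one_sub_rpow_neg_half_pos (Nat.prime_of_mem_primeFactors hp)
      have h2 : 1 - (p : ℝ) ^ (-(1 / 2 : ℝ)) ≤ 1 := by
        linarith [Real.rpow_nonneg (Nat.cast_nonneg p) (-(1 / 2 : ℝ))]
      exact (one_le_inv₀ h1).2 h2

/-- `∑_{m ≤ N, m ∣ l^∞} (log m)/m ≤ 2 F(l)` (`log m ≤ 2√m`). [folklore] -/
theorem sum_factoredInvAF_mul_log_le (l N : ℕ) :
    ∑ m ∈ Ioc 0 N, factoredInvAF l m * Real.log m ≤ 2 * sqrtEulerFactor l := by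
  have h := sum_factored_rpow_le (by norm_num : (0 : ℝ) < 1 / 2) l N
  rw [sqrtEulerFactor]
  calc ∑ m ∈ Ioc 0 N, factoredInvAF l m * Real.log m
      ≤ ∑ m ∈ Ioc 0 N,
          2 * (if m ≠ 0 ∧ m.primeFactors ⊆ l.primeFactors then (m : ℝ) ^ (-(1 / 2 : ℝ)) else 0) := by
        refine Finset.sum_le_sum fun m hm => ?_
        have hm0 : 0 < m := (Finset.mem_Ioc.1 hm).1
        have hmR : (0 : ℝ) < m := by exact_mod_cast hm0
        rw [factoredInvAF_apply]
        split_ifs with hcond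
        · -- `m⁻¹ log m ≤ 2 m^{-1/2}`
          have hlog : Real.log m ≤ (m : ℝ) ^ (1 / 2 : ℝ) / (1 / 2) :=
            Real.log_le_rpow_div hmR.le (by norm_num)
          have hsq : (m : ℝ) ^ (1 / 2 : ℝ) * (m : ℝ) ^ (1 / 2 : ℝ) = m := by
            rw [← Real.rpow_add hmR]; norm_num
          have hpos : 0 < (m : ℝ) ^ (1 / 2 : ℝ) := Real.rpow_pos_of_pos hmR _
          have h1 : (m : ℝ) ^ (-(1 / 2 : ℝ)) = (m : ℝ) ^ (1 / 2 : ℝ) * (m : ℝ)⁻¹ := by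
            rw [Real.rpow_neg hmR.le, eq_comm, mul_inv_eq_iff_eq_mul₀ hmR.ne',
              eq_inv_mul_iff_mul_eq₀ hpos.ne', hsq]
          rw [h1, inv_mul_eq_div, div_le_iff₀ hmR]
          have : (m : ℝ) ^ (1 / 2 : ℝ) * (m : ℝ)⁻¹ * m = (m : ℝ) ^ (1 / 2 : ℝ) := by
            field_simp
          nlinarith [Real.rpow_nonneg hmR.le (1 / 2 : ℝ)]
        · simp
    _ = 2 * ∑ m ∈ Ioc 0 N,
          (if m ≠ 0 ∧ m.primeFactors ⊆ l.primeFactors then (m : ℝ) ^ (-(1 / 2 : ℝ)) else 0) := by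
        rw [Finset.mul_sum]
    _ ≤ 2 * ∏ p ∈ l.primeFactors, (1 - (p : ℝ) ^ (-(1 / 2 : ℝ)))⁻¹ :=
        mul_le_mul_of_nonneg_left h zero_le_two

/-! ### §4 The coprime sums `M_l`, `G_l`: `∑_{k ≤ N} |M_l(k)|/k ≤ K₁ l/φ(l)`, `|G_l(k)| ≪ F(l) + l/φ(l)` -/

/-- The fibres of `k ↦ ⌊k/m⌋`: `∑_{m ≤ k ≤ N} a(⌊k/m⌋)/k ≤ ∑_{j ≤ N/m} a(j)/j` for `a ≥ 0`
(each fibre has `≤ m` elements `k ≥ jm`). [folklore] -/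
theorem sum_div_fiber_le {a : ℕ → ℝ} (ha : ∀ j, 0 ≤ a j) {m : ℕ} (hm : 0 < m) (N : ℕ) :
    ∑ k ∈ (Ioc 0 N).filter (m ≤ ·), a (k / m) / k ≤ ∑ j ∈ Ioc 0 (N / m), a j / j := by
  have hmaps : ∀ k ∈ (Ioc 0 N).filter (m ≤ ·), k / m ∈ Ioc 0 (N / m) := by
    intro k hk
    rw [Finset.mem_filter, Finset.mem_Ioc] at hk
    rw [Finset.mem_Ioc]
    exact ⟨Nat.div_pos hk.2 hm, Nat.div_le_div_right hk.1.2⟩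
  rw [← Finset.sum_fiberwise_of_maps_to hmaps]
  refine Finset.sum_le_sum fun j hj => ?_
  have hj0 : 0 < j := (Finset.mem_Ioc.1 hj).1
  have hjm : (0 : ℝ) < (j : ℝ) * m := by positivity
  set S := ((Ioc 0 N).filter (m ≤ ·)).filter (fun k => k / m = j) with hS
  have hbound : ∀ k ∈ S, a (k / m) / k ≤ a j / ((j : ℝ) * m) := by
    intro k hk
    rw [hS, Finset.mem_filter] at hk
    rw [hk.2]
    have hk1 : j * m ≤ k := by rw [← hk.2]; exact Nat.div_mul_le_self k m
    have hkR : (j : ℝ) * m ≤ k := by exact_mod_cast hk1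
    exact div_le_div_of_nonneg_left (ha j) hjm hkR
  have hcard : S.card ≤ m := by
    have hsub : S ⊆ Finset.Ico (j * m) (j * m + m) := by
      intro k hk
      rw [hS, Finset.mem_filter] at hk
      rw [Finset.mem_Ico]
      constructor
      · rw [← hk.2]; exact Nat.div_mul_le_self k m
      · rw [← hk.2]; exact Nat.lt_div_mul_add hm
    exact (Finset.card_le_card hsub).trans (by simp)
  calc ∑ k ∈ S, a (k / m) / k ≤ S.card • (a j / ((j : ℝ) * m)) := Finset.sum_le_card_nsmul _ _ _ hbound
    _ ≤ m • (a j / ((j : ℝ) * m)) := by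
        rw [nsmul_eq_mul, nsmul_eq_mul]
        exact mul_le_mul_of_nonneg_right (by exact_mod_cast hcard) (div_nonneg (ha j) hjm.le)
    _ = a j / j := by
        rw [nsmul_eq_mul]
        field_simp

/-- **`∑_{k ≤ N} |M_l(k)|/k ≤ K₁ · l/φ(l)`**, where `K₁` bounds `∑_{j ≤ J} |M(j)|/j`. [folklore] -/
theorem sum_abs_coprimeSum_div_le {l : ℕ} (hl : l ≠ 0) {K₁ : ℝ}
    (hK₁ : ∀ J, ∑ j ∈ Ioc 0 J, |moebiusInvSum j| / j ≤ K₁) (N : ℕ) :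
    ∑ k ∈ Ioc 0 N, |∑ i ∈ Ioc 0 k, coprimeMoebiusInvAF l i| / k ≤
      K₁ * ((l : ℝ) / Nat.totient l) := by
  have hK₁0 : 0 ≤ K₁ := le_trans (by simp) (hK₁ 0)
  -- pointwise: `|M_l(k)|/k ≤ ∑_{m ≤ N} χ(m) [m ≤ k] |M(⌊k/m⌋)|/k`
  have hpt : ∀ k ∈ Ioc 0 N, |∑ i ∈ Ioc 0 k, coprimeMoebiusInvAF l i| / k ≤
      ∑ m ∈ Ioc 0 N, factoredInvAF l m *
        (if m ≤ k then |moebiusInvSum (k / m)| / k else 0) := by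
    intro k hk
    have hkN : k ≤ N := (Finset.mem_Ioc.1 hk).2
    rw [sum_coprimeMoebiusInv_eq hl]
    have h1 : |∑ m ∈ Ioc 0 k, factoredInvAF l m * moebiusInvSum (k / m)| / k ≤
        ∑ m ∈ Ioc 0 k, factoredInvAF l m * |moebiusInvSum (k / m)| / k := by
      calc |∑ m ∈ Ioc 0 k, factoredInvAF l m * moebiusInvSum (k / m)| / k
          ≤ (∑ m ∈ Ioc 0 k, |factoredInvAF l m * moebiusInvSum (k / m)|) / k :=
            div_le_div_of_nonneg_right (Finset.abs_sum_le_sum_abs _ _) (Nat.cast_nonneg k)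
        _ = ∑ m ∈ Ioc 0 k, factoredInvAF l m * |moebiusInvSum (k / m)| / k := by
            rw [Finset.sum_div]
            refine Finset.sum_congr rfl fun m _ => ?_
            rw [abs_mul, abs_of_nonneg (factoredInvAF_nonneg l m)]
    refine h1.trans (le_of_eq ?_)
    have hsub : Ioc 0 k = (Ioc 0 N).filter (· ≤ k) := by
      ext m; simp only [Finset.mem_Ioc, Finset.mem_filter]; omega
    rw [hsub, Finset.sum_filter]
    refine Finset.sum_congr rfl fun m _ => ?_
    split_ifs
    · exact mul_div_assoc _ _ _
    · exact (mul_zero _).symm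
  refine (Finset.sum_le_sum hpt).trans ?_
  rw [Finset.sum_comm]
  -- for each `m`, the `k`-sum is `≤ K₁`
  have hinner : ∀ m ∈ Ioc 0 N, ∑ k ∈ Ioc 0 N, factoredInvAF l m *
      (if m ≤ k then |moebiusInvSum (k / m)| / k else 0) ≤ factoredInvAF l m * K₁ := by
    intro m hm
    have hm0 : 0 < m := (Finset.mem_Ioc.1 hm).1
    rw [← Finset.mul_sum]
    refine mul_le_mul_of_nonneg_left ?_ (factoredInvAF_nonneg l m)
    rw [← Finset.sum_filter]
    exact (sum_div_fiber_le (fun j => abs_nonneg (moebiusInvSum j)) hm0 N).trans (hK₁ _)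
  refine (Finset.sum_le_sum hinner).trans ?_
  rw [← Finset.sum_mul, mul_comm]
  exact mul_le_mul_of_nonneg_left (sum_factoredInvAF_le hl N) hK₁0

/-- **`|G_l(k)| ≤ 2K₀ F(l) + K₃ l/φ(l)`** for `k ≤ N`, where `K₀ ≥ sup |M|`, `K₃ ≥ sup |G|`. [folklore] -/
theorem abs_coprimeLogSum_le {l : ℕ} (hl : l ≠ 0) {K₀ K₃ : ℝ}
    (hK₀ : ∀ J, |moebiusInvSum J| ≤ K₀) (hK₃ : ∀ J, |moebiusLogSum J| ≤ K₃) {k N : ℕ} (hkN : k ≤ N) :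
    |∑ i ∈ Ioc 0 k, coprimeMoebiusInvAF l i * Real.log i| ≤
      K₀ * (2 * sqrtEulerFactor l) + K₃ * ((l : ℝ) / Nat.totient l) := by
  have hK₀0 : 0 ≤ K₀ := (abs_nonneg _).trans (hK₀ 0)
  have hK₃0 : 0 ≤ K₃ := (abs_nonneg _).trans (hK₃ 0)
  have hsub : Ioc 0 k ⊆ Ioc 0 N := fun m hm => by
    rw [Finset.mem_Ioc] at hm ⊢; omega
  rw [sum_coprimeMoebiusInv_mul_log_eq hl]
  refine (abs_add_le _ _).trans (add_le_add ?_ ?_)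
  · calc |∑ m ∈ Ioc 0 k, factoredInvAF l m * Real.log m * moebiusInvSum (k / m)|
        ≤ ∑ m ∈ Ioc 0 k, factoredInvAF l m * Real.log m * K₀ := by
          refine (Finset.abs_sum_le_sum_abs _ _).trans (Finset.sum_le_sum fun m hm => ?_)
          have hm1 : (1 : ℝ) ≤ m := by exact_mod_cast (Finset.mem_Ioc.1 hm).1
          have hnn : 0 ≤ factoredInvAF l m * Real.log m :=
            mul_nonneg (factoredInvAF_nonneg l m) (Real.log_nonneg hm1)
          rw [abs_mul, abs_of_nonneg hnn]
          exact mul_le_mul_of_nonneg_left (hK₀ _) hnn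
      _ ≤ ∑ m ∈ Ioc 0 N, factoredInvAF l m * Real.log m * K₀ := by
          refine Finset.sum_le_sum_of_subset_of_nonneg hsub fun m hm _ => ?_
          have hm1 : (1 : ℝ) ≤ m := by exact_mod_cast (Finset.mem_Ioc.1 hm).1
          exact mul_nonneg (mul_nonneg (factoredInvAF_nonneg l m) (Real.log_nonneg hm1)) hK₀0
      _ = K₀ * ∑ m ∈ Ioc 0 N, factoredInvAF l m * Real.log m := by
          rw [Finset.mul_sum]; exact Finset.sum_congr rfl fun m _ => by ring
      _ ≤ K₀ * (2 * sqrtEulerFactor l) :=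
          mul_le_mul_of_nonneg_left (sum_factoredInvAF_mul_log_le l N) hK₀0
  · calc |∑ m ∈ Ioc 0 k, factoredInvAF l m * moebiusLogSum (k / m)|
        ≤ ∑ m ∈ Ioc 0 k, factoredInvAF l m * K₃ := by
          refine (Finset.abs_sum_le_sum_abs _ _).trans (Finset.sum_le_sum fun m _ => ?_)
          rw [abs_mul, abs_of_nonneg (factoredInvAF_nonneg l m)]
          exact mul_le_mul_of_nonneg_left (hK₃ _) (factoredInvAF_nonneg l m)
      _ ≤ ∑ m ∈ Ioc 0 N, factoredInvAF l m * K₃ :=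
          Finset.sum_le_sum_of_subset_of_nonneg hsub fun m _ _ =>
            mul_nonneg (factoredInvAF_nonneg l m) hK₃0
      _ = K₃ * ∑ m ∈ Ioc 0 N, factoredInvAF l m := by
          rw [Finset.mul_sum]; exact Finset.sum_congr rfl fun m _ => by ring
      _ ≤ K₃ * ((l : ℝ) / Nat.totient l) :=
          mul_le_mul_of_nonneg_left (sum_factoredInvAF_le hl N) hK₃0

/-! ### §5 The plateau shape `P_X` and the weights `b_d = μ(d) P_X(d)` -/

/-- **The plateau shape** `P_X(d) = max(0, min(1, 2 log(X/d)/log X))`: `1` for `d ≤ √X`,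
`2 log(X/d)/log X` for `√X ≤ d ≤ X`, `0` for `d ≥ X` (Levinson–Conrey shape `P(x) = min(1, 2x)`
of `x = log(X/d)/log X`, clamped). [cite: Titchmarsh1986, §9.24] -/
def shape (X : ℝ) (d : ℕ) : ℝ := max 0 (min 1 (2 * (Real.log X - Real.log d) / Real.log X))

/-- **The plateau mollifier coefficients** `b_d = μ(d) P_X(d)`. [cite: Titchmarsh1986, §9.24] -/
def weight (X : ℝ) (d : ℕ) : ℝ := (μ d : ℝ) * shape X d

/-- `P_X ≥ 0`. [folklore] -/
theorem shape_nonneg (X : ℝ) (d : ℕ) : 0 ≤ shape X d := le_max_left _ _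

/-- `P_X ≤ 1`. [folklore] -/
theorem shape_le_one (X : ℝ) (d : ℕ) : shape X d ≤ 1 :=
  max_le zero_le_one (min_le_left _ _)

/-- `P_X(d) = 1` for `1 ≤ d`, `d² ≤ X`. [folklore] -/
theorem shape_eq_one {X : ℝ} (hX : 1 < X) {d : ℕ} (hd : 1 ≤ d) (hd2 : (d : ℝ) ^ 2 ≤ X) :
    shape X d = 1 := by
  have hL : 0 < Real.log X := Real.log_pos hX
  have hd0 : (0 : ℝ) < d := by exact_mod_cast hd
  have hlogd : 2 * Real.log d ≤ Real.log X := by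
    have h2 : Real.log ((d : ℝ) ^ 2) = 2 * Real.log d := by
      rw [Real.log_pow]; norm_num
    rw [← h2]; exact Real.log_le_log (by positivity) hd2
  have h1 : 1 ≤ 2 * (Real.log X - Real.log d) / Real.log X := by
    rw [le_div_iff₀ hL]; linarith
  rw [shape, min_eq_left h1, max_eq_right zero_le_one]

/-- `P_X(d) = 0` for `d ≥ X > 1`. [folklore] -/
theorem shape_eq_zero {X : ℝ} (hX : 1 < X) {d : ℕ} (hd : X ≤ d) : shape X d = 0 := by
  have hL : 0 < Real.log X := Real.log_pos hX
  have hlogd : Real.log X ≤ Real.log d := Real.log_le_log (by linarith) hd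
  have h1 : 2 * (Real.log X - Real.log d) / Real.log X ≤ 0 :=
    div_nonpos_of_nonpos_of_nonneg (by linarith) hL.le
  rw [shape, max_eq_left ((min_le_right _ _).trans h1)]

/-- The clamp `u ↦ max(0, min(1, u))` is `1`-Lipschitz. [folklore] -/
theorem abs_clamp_sub_clamp_le (u v : ℝ) : |max 0 (min 1 u) - max 0 (min 1 v)| ≤ |u - v| := by
  refine (abs_max_sub_max_le_max _ _ _ _).trans ?_
  rw [sub_self, abs_zero]
  refine max_le (abs_nonneg _) ((abs_min_sub_min_le_max _ _ _ _).trans ?_)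
  rw [sub_self, abs_zero]
  exact max_le (abs_nonneg _) le_rfl

/-- `P_X` is antitone in `d ≥ 1`. [folklore] -/
theorem shape_antitone {X : ℝ} (hX : 1 < X) {d d' : ℕ} (hd : 1 ≤ d) (hdd' : d ≤ d') :
    shape X d' ≤ shape X d := by
  have hL : 0 < Real.log X := Real.log_pos hX
  have hd0 : (0 : ℝ) < d := by exact_mod_cast hd
  have hlog : Real.log d ≤ Real.log d' := Real.log_le_log hd0 (by exact_mod_cast hdd')
  refine max_le_max le_rfl (min_le_min le_rfl ?_)
  exact div_le_div_of_nonneg_right (by linarith) hL.le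

/-- `P_X(d) − P_X(d') ≤ 2 (log d' − log d)/log X` for `1 ≤ d ≤ d'`. [folklore] -/
theorem shape_sub_shape_le {X : ℝ} (hX : 1 < X) {d d' : ℕ} (hd : 1 ≤ d) (hdd' : d ≤ d') :
    shape X d - shape X d' ≤ 2 * (Real.log d' - Real.log d) / Real.log X := by
  have hL : 0 < Real.log X := Real.log_pos hX
  have hd0 : (0 : ℝ) < d := by exact_mod_cast hd
  have hlog : Real.log d ≤ Real.log d' := Real.log_le_log hd0 (by exact_mod_cast hdd')
  have h := abs_clamp_sub_clamp_le (2 * (Real.log X - Real.log d) / Real.log X)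
    (2 * (Real.log X - Real.log d') / Real.log X)
  have heq : 2 * (Real.log X - Real.log d) / Real.log X - 2 * (Real.log X - Real.log d') / Real.log X
      = 2 * (Real.log d' - Real.log d) / Real.log X := by
    field_simp; ring
  have hnn : 0 ≤ 2 * (Real.log d' - Real.log d) / Real.log X :=
    div_nonneg (mul_nonneg zero_le_two (sub_nonneg.2 hlog)) hL.le
  rw [heq, abs_of_nonneg hnn] at h
  change |shape X d - shape X d'| ≤ _ at h
  exact (le_abs_self _).trans h

/-- `|b_d| ≤ 1`. [folklore] -/
theorem abs_weight_le_one (X : ℝ) (d : ℕ) : |weight X d| ≤ 1 := by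
  rw [weight, abs_mul, abs_of_nonneg (shape_nonneg X d)]
  have hμ : |(μ d : ℝ)| ≤ 1 := by
    rw [← Int.cast_abs, ← Int.cast_one, Int.cast_le]; exact ArithmeticFunction.abs_moebius_le_one
  exact mul_le_one₀ hμ (shape_nonneg X d) (shape_le_one X d)

/-- `b_1 = 1` (`X > 1`). [folklore] -/
theorem weight_one {X : ℝ} (hX : 1 < X) : weight X 1 = 1 := by
  rw [weight, shape_eq_one hX le_rfl (by norm_num; exact hX.le), ArithmeticFunction.moebius_apply_one]
  simp

/-- `b_d = μ(d)` for `1 ≤ d ≤ √X`: the plateau. [folklore] -/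
theorem weight_eq_moebius {X : ℝ} (hX : 1 < X) {d : ℕ} (hd : 1 ≤ d) (hd2 : (d : ℝ) ^ 2 ≤ X) :
    weight X d = μ d := by
  rw [weight, shape_eq_one hX hd hd2, mul_one]

/-- `b_d = 0` for `d ≥ X`. [folklore] -/
theorem weight_eq_zero {X : ℝ} (hX : 1 < X) {d : ℕ} (hd : X ≤ d) : weight X d = 0 := by
  rw [weight, shape_eq_zero hX hd, mul_zero]

/-- `b_d = 0` unless `d` is squarefree. [folklore] -/
theorem weight_eq_zero_of_not_squarefree (X : ℝ) {d : ℕ} (hd : ¬Squarefree d) : weight X d = 0 := by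
  rw [weight, ArithmeticFunction.moebius_eq_zero_of_not_squarefree hd]; simp

/-- Multiples of `l` in `(0, N]` are `l k`, `k ∈ (0, N/l]`. [folklore] -/
theorem sum_filter_dvd_eq_sum {l : ℕ} (hl : 0 < l) (N : ℕ) (F : ℕ → ℝ) :
    ∑ r ∈ (Ioc 0 N).filter (l ∣ ·), F r = ∑ k ∈ Ioc 0 (N / l), F (l * k) := by
  have hinj : Set.InjOn (fun k => l * k) (Ioc 0 (N / l) : Finset ℕ) :=
    fun a _ b _ h => Nat.eq_of_mul_eq_mul_left hl h
  rw [← Finset.sum_image hinj]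
  congr 1
  ext r
  simp only [Finset.mem_filter, Finset.mem_Ioc, Finset.mem_image]
  constructor
  · rintro ⟨⟨hr0, hrN⟩, ⟨k, rfl⟩⟩
    refine ⟨k, ⟨Nat.pos_of_mul_pos_left hr0, ?_⟩, rfl⟩
    exact (Nat.le_div_iff_mul_le hl).2 (by rw [mul_comm]; exact hrN)
  · rintro ⟨k, ⟨hk0, hkN⟩, rfl⟩
    refine ⟨⟨Nat.mul_pos hl hk0, ?_⟩, dvd_mul_right l k⟩
    calc l * k ≤ l * (N / l) := Nat.mul_le_mul_left l hkN
      _ ≤ N := Nat.mul_div_le N l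

/-- `b_{lk}/(lk) = (μ(l)/l) · (μ 1_{(·,l)=1}/·)(k) · P_X(lk)`. [folklore] -/
theorem weight_mul_div_eq {X : ℝ} {l k : ℕ} (hl : 0 < l) (hk : 0 < k) :
    weight X (l * k) / ((l * k : ℕ) : ℝ) =
      (μ l : ℝ) / l * (coprimeMoebiusInvAF l k * shape X (l * k)) := by
  have hlR : (l : ℝ) ≠ 0 := by exact_mod_cast hl.ne'
  have hkR : (k : ℝ) ≠ 0 := by exact_mod_cast hk.ne'
  rw [weight, coprimeMoebiusInvAF_apply]
  by_cases hco : k.Coprime l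
  · rw [if_pos hco, ArithmeticFunction.isMultiplicative_moebius.map_mul_of_coprime hco.symm,
      Int.cast_mul, Nat.cast_mul]
    field_simp
  · rw [if_neg hco]
    have hnsq : ¬Squarefree (l * k) := fun h => hco (Nat.squarefree_mul_iff.1 h).1.symm
    rw [ArithmeticFunction.moebius_eq_zero_of_not_squarefree hnsq]
    simp

/-- **Abel summation against the plateau.** For `X > 1`, `N = ⌊X⌋`, `l ≥ 1` and any `c`:
`|∑_{k ≤ N/l} c_k P_X(lk)| ≤ (2/log X) ∑_{k ≤ N/l} |C_k|/k`, `C_k = ∑_{i ≤ k} c_i`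
(`P_X(lk)` is antitone in `k`, vanishes at `k = N/l + 1`, and
`P_X(lk) − P_X(l(k+1)) ≤ (2/log X) log(1 + 1/k) ≤ 2/(k log X)`). [folklore] -/
theorem abs_sum_mul_shape_le {X : ℝ} (hX : 1 < X) {l : ℕ} (hl : 0 < l) (c : ℕ → ℝ) :
    |∑ k ∈ Ioc 0 (⌊X⌋₊ / l), c k * shape X (l * k)| ≤
      2 / Real.log X * ∑ k ∈ Ioc 0 (⌊X⌋₊ / l), |∑ i ∈ Ioc 0 k, c i| / k := by
  have hL : 0 < Real.log X := Real.log_pos hX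
  set K := ⌊X⌋₊ / l with hK
  set p : ℕ → ℝ := fun k => shape X (l * k) with hp
  have hanti : ∀ k, p (k + 1) ≤ p k := by
    intro k
    rcases Nat.eq_zero_or_pos k with rfl | hk
    · simp only [hp, mul_zero, zero_add, mul_one]
      -- `shape X 0 = 1 ≥ shape X l`
      have h0 : shape X 0 = 1 := by
        rw [shape, Nat.cast_zero, Real.log_zero, sub_zero]
        rw [min_eq_left, max_eq_right zero_le_one]
        rw [le_div_iff₀ hL]; linarith
      rw [h0]; exact shape_le_one X l
    · exact shape_antitone hX (Nat.mul_pos hl hk) (Nat.mul_le_mul_left l (Nat.le_succ k))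
  have hvan : p (K + 1) = 0 := by
    simp only [hp]
    refine shape_eq_zero hX ?_
    have h1 : ⌊X⌋₊ < l * (K + 1) := by
      rw [hK, mul_add, mul_one]
      exact Nat.lt_div_mul_add hl |>.trans_eq (by ring)
    have h2 : X < (⌊X⌋₊ : ℝ) + 1 := Nat.lt_floor_add_one X
    have h3 : ((⌊X⌋₊ : ℕ) : ℝ) + 1 ≤ ((l * (K + 1) : ℕ) : ℝ) := by exact_mod_cast h1
    linarith
  have habel := abs_sum_Ioc_mul_le_of_antitone c p K hanti
  rw [hvan, abs_zero, mul_zero, add_zero] at habel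
  refine habel.trans ?_
  rw [Finset.mul_sum]
  refine Finset.sum_le_sum fun k hk => ?_
  have hk0 : 0 < k := (Finset.mem_Ioc.1 hk).1
  have hkR : (0 : ℝ) < k := by exact_mod_cast hk0
  have hdiff : p k - p (k + 1) ≤ 2 / Real.log X * (1 / k) := by
    have h1 := shape_sub_shape_le hX (Nat.mul_pos hl hk0) (Nat.mul_le_mul_left l (Nat.le_succ k))
    have h2 : Real.log ((l * (k + 1) : ℕ) : ℝ) - Real.log ((l * k : ℕ) : ℝ) ≤ 1 / k := by
      have hlk : (0 : ℝ) < (l * k : ℕ) := by exact_mod_cast Nat.mul_pos hl hk0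
      rw [← Real.log_div (by positivity) hlk.ne']
      have h3 : ((l * (k + 1) : ℕ) : ℝ) / ((l * k : ℕ) : ℝ) = 1 + 1 / k := by
        push_cast; field_simp
      rw [h3]
      have := Real.log_le_sub_one_of_pos (show (0:ℝ) < 1 + 1 / k by positivity)
      linarith
    calc p k - p (k + 1) ≤ 2 * (Real.log ((l * (k + 1) : ℕ) : ℝ) - Real.log ((l * k : ℕ) : ℝ))
          / Real.log X := h1
      _ = 2 / Real.log X * (Real.log ((l * (k + 1) : ℕ) : ℝ) - Real.log ((l * k : ℕ) : ℝ)) := by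
          ring
      _ ≤ 2 / Real.log X * (1 / k) := mul_le_mul_of_nonneg_left h2 (by positivity)
  calc |∑ i ∈ Ioc 0 k, c i| * (p k - p (k + 1))
      ≤ |∑ i ∈ Ioc 0 k, c i| * (2 / Real.log X * (1 / k)) :=
        mul_le_mul_of_nonneg_left hdiff (abs_nonneg _)
    _ = 2 / Real.log X * (|∑ i ∈ Ioc 0 k, c i| / k) := by ring

/-- **The bound for `y_l = ∑_{l ∣ r ≤ X} b_r/r`**: `|y_l| ≤ 2K₁/(φ(l) log X)`. [folklore] -/
theorem abs_ySum_le {X : ℝ} (hX : 1 < X) {l : ℕ} (hl : 0 < l) {K₁ : ℝ}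
    (hK₁ : ∀ J, ∑ j ∈ Ioc 0 J, |moebiusInvSum j| / j ≤ K₁) :
    |∑ r ∈ (Ioc 0 ⌊X⌋₊).filter (l ∣ ·), weight X r / r| ≤
      2 * K₁ / ((Nat.totient l : ℝ) * Real.log X) := by
  have hL : 0 < Real.log X := Real.log_pos hX
  have hK₁0 : 0 ≤ K₁ := le_trans (by simp) (hK₁ 0)
  have hlR : (0 : ℝ) < l := by exact_mod_cast hl
  have hφ : (0 : ℝ) < Nat.totient l := by exact_mod_cast Nat.totient_pos.2 hl
  set N := ⌊X⌋₊ with hN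
  rw [sum_filter_dvd_eq_sum hl]
  have h1 : ∑ k ∈ Ioc 0 (N / l), weight X (l * k) / ((l * k : ℕ) : ℝ) =
      (μ l : ℝ) / l * ∑ k ∈ Ioc 0 (N / l), coprimeMoebiusInvAF l k * shape X (l * k) := by
    rw [Finset.mul_sum]
    refine Finset.sum_congr rfl fun k hk => ?_
    exact weight_mul_div_eq hl (Finset.mem_Ioc.1 hk).1
  rw [h1, abs_mul]
  have hμ : |(μ l : ℝ) / l| ≤ 1 / l := by
    rw [abs_div, abs_of_pos hlR]
    refine div_le_div_of_nonneg_right ?_ hlR.le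
    rw [← Int.cast_abs, ← Int.cast_one, Int.cast_le]; exact ArithmeticFunction.abs_moebius_le_one
  have h2 := abs_sum_mul_shape_le hX hl (fun k => coprimeMoebiusInvAF l k)
  have h3 : ∑ k ∈ Ioc 0 (N / l), |∑ i ∈ Ioc 0 k, coprimeMoebiusInvAF l i| / k ≤
      K₁ * ((l : ℝ) / Nat.totient l) := by
    refine le_trans ?_ (sum_abs_coprimeSum_div_le hl.ne' hK₁ N)
    refine Finset.sum_le_sum_of_subset_of_nonneg (fun k hk => ?_) fun k _ _ => by positivity
    rw [Finset.mem_Ioc] at hk ⊢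
    exact ⟨hk.1, hk.2.trans (Nat.div_le_self N l)⟩
  calc |(μ l : ℝ) / l| * |∑ k ∈ Ioc 0 (N / l), coprimeMoebiusInvAF l k * shape X (l * k)|
      ≤ 1 / l * (2 / Real.log X * (K₁ * ((l : ℝ) / Nat.totient l))) := by
        refine mul_le_mul hμ (h2.trans ?_) (abs_nonneg _) (by positivity)
        exact mul_le_mul_of_nonneg_left h3 (by positivity)
    _ = 2 * K₁ / ((Nat.totient l : ℝ) * Real.log X) := by
        field_simp

/-- **The bound for `ỹ_l = ∑_{l ∣ r ≤ X} b_r log r/r`**: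
`|ỹ_l − (log l) y_l| ≤ (2(1 + log N)/(l log X)) (2K₀F(l) + K₃ l/φ(l))`, `N = ⌊X⌋`. [folklore] -/
theorem abs_ytildeSum_sub_le {X : ℝ} (hX : 1 < X) {l : ℕ} (hl : 0 < l) {K₀ K₃ : ℝ}
    (hK₀ : ∀ J, |moebiusInvSum J| ≤ K₀) (hK₃ : ∀ J, |moebiusLogSum J| ≤ K₃) :
    |∑ r ∈ (Ioc 0 ⌊X⌋₊).filter (l ∣ ·), weight X r * Real.log r / r -
        Real.log l * ∑ r ∈ (Ioc 0 ⌊X⌋₊).filter (l ∣ ·), weight X r / r| ≤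
      2 * (1 + Real.log ⌊X⌋₊) / ((l : ℝ) * Real.log X) *
        (K₀ * (2 * sqrtEulerFactor l) + K₃ * ((l : ℝ) / Nat.totient l)) := by
  have hL : 0 < Real.log X := Real.log_pos hX
  have hlR : (0 : ℝ) < l := by exact_mod_cast hl
  set N := ⌊X⌋₊ with hN
  set B := K₀ * (2 * sqrtEulerFactor l) + K₃ * ((l : ℝ) / Nat.totient l) with hB
  have hB0 : 0 ≤ B := (abs_nonneg _).trans (abs_coprimeLogSum_le hl.ne' hK₀ hK₃ (le_refl N))
  rw [sum_filter_dvd_eq_sum hl, sum_filter_dvd_eq_sum hl]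
  -- `b_{lk} log(lk)/(lk) = log l · (b_{lk}/(lk)) + (μ l/l) (cμ_l(k) log k) P(lk)`
  have h1 : ∑ k ∈ Ioc 0 (N / l), weight X (l * k) * Real.log ((l * k : ℕ) : ℝ) / ((l * k : ℕ) : ℝ)
      - Real.log l * ∑ k ∈ Ioc 0 (N / l), weight X (l * k) / ((l * k : ℕ) : ℝ) =
      (μ l : ℝ) / l * ∑ k ∈ Ioc 0 (N / l),
        (coprimeMoebiusInvAF l k * Real.log k) * shape X (l * k) := by
    rw [Finset.mul_sum, Finset.mul_sum, ← Finset.sum_sub_distrib]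
    refine Finset.sum_congr rfl fun k hk => ?_
    have hk0 : 0 < k := (Finset.mem_Ioc.1 hk).1
    have hkR : (0 : ℝ) < k := by exact_mod_cast hk0
    have hw := weight_mul_div_eq (X := X) hl hk0
    have hlk0 : ((l * k : ℕ) : ℝ) ≠ 0 := by exact_mod_cast (Nat.mul_pos hl hk0).ne'
    have hw' : weight X (l * k) =
        ((l * k : ℕ) : ℝ) * ((μ l : ℝ) / l * (coprimeMoebiusInvAF l k * shape X (l * k))) := by
      rw [← hw, mul_div_cancel₀ _ hlk0]
    rw [hw', Nat.cast_mul, Real.log_mul hlR.ne' hkR.ne']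
    field_simp
    ring
  rw [h1, abs_mul]
  have hμ : |(μ l : ℝ) / l| ≤ 1 / l := by
    rw [abs_div, abs_of_pos hlR]
    refine div_le_div_of_nonneg_right ?_ hlR.le
    rw [← Int.cast_abs, ← Int.cast_one, Int.cast_le]; exact ArithmeticFunction.abs_moebius_le_one
  have h2 := abs_sum_mul_shape_le hX hl (fun k => coprimeMoebiusInvAF l k * Real.log k)
  -- `∑_{k ≤ N/l} |G_l(k)|/k ≤ B (1 + log N)`
  have h3 : ∑ k ∈ Ioc 0 (N / l), |∑ i ∈ Ioc 0 k, coprimeMoebiusInvAF l i * Real.log i| / k ≤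
      B * (1 + Real.log N) := by
    calc ∑ k ∈ Ioc 0 (N / l), |∑ i ∈ Ioc 0 k, coprimeMoebiusInvAF l i * Real.log i| / k
        ≤ ∑ k ∈ Ioc 0 (N / l), B * (1 / k) := by
          refine Finset.sum_le_sum fun k hk => ?_
          have hkN : k ≤ N := (Finset.mem_Ioc.1 hk).2.trans (Nat.div_le_self N l)
          rw [← div_eq_mul_one_div]
          exact div_le_div_of_nonneg_right (abs_coprimeLogSum_le hl.ne' hK₀ hK₃ hkN) (Nat.cast_nonneg k)
      _ = B * ∑ k ∈ Ioc 0 (N / l), (1 : ℝ) / k := by rw [Finset.mul_sum]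
      _ ≤ B * (1 + Real.log N) := by
          refine mul_le_mul_of_nonneg_left ?_ hB0
          calc ∑ k ∈ Ioc 0 (N / l), (1 : ℝ) / k ≤ ∑ k ∈ Ioc 0 N, (1 : ℝ) / k := by
                refine Finset.sum_le_sum_of_subset_of_nonneg (fun k hk => ?_) fun _ _ _ => by positivity
                rw [Finset.mem_Ioc] at hk ⊢
                exact ⟨hk.1, hk.2.trans (Nat.div_le_self N l)⟩
            _ ≤ 1 + Real.log N := by
                rw [← Finset.Icc_add_one_left_eq_Ioc]
                exact Literature.NumberTheory.Sieve.sum_Icc_one_div_le_one_add_log N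
  have hlogN : 0 ≤ 1 + Real.log N := by
    have : 0 ≤ Real.log N := Real.log_natCast_nonneg N
    linarith
  calc |(μ l : ℝ) / l| * |∑ k ∈ Ioc 0 (N / l), coprimeMoebiusInvAF l k * Real.log k * shape X (l * k)|
      ≤ 1 / l * (2 / Real.log X * (B * (1 + Real.log N))) := by
        refine mul_le_mul hμ (h2.trans ?_) (abs_nonneg _) (by positivity)
        exact mul_le_mul_of_nonneg_left h3 (by positivity)
    _ = 2 * (1 + Real.log N) / ((l : ℝ) * Real.log X) * B := by
        field_simp

/-! ### §6 `∑_{e ≤ N, e squarefree} F(e)/e ≪ log N` (Mertens) -/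

/-- `∑_{2 ≤ n ≤ N} n^{-3/2} ≤ 2` (comparison with `∫_1^N u^{-3/2} du = 2 − 2/√N`). [folklore] -/
theorem sum_rpow_neg_three_halves_le (N : ℕ) :
    ∑ n ∈ Ioc 1 N, (n : ℝ) ^ (-(3 / 2 : ℝ)) ≤ 2 := by
  rcases le_or_gt N 1 with hN | hN
  · rw [Finset.Ioc_eq_empty (by omega)]; simp
  set f : ℝ → ℝ := fun u => u ^ (-(3 / 2 : ℝ)) with hf
  have hanti : AntitoneOn f (Set.Icc (1 : ℕ) (N : ℕ)) := by
    intro a ha b hb hab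
    simp only [Nat.cast_one, Set.mem_Icc] at ha hb
    exact Real.rpow_le_rpow_of_nonpos (by linarith [ha.1]) hab (by norm_num)
  have hsum := AntitoneOn.sum_le_integral_Ico hN.le hanti
  have hre : ∑ i ∈ Finset.Ico 1 N, f ((i + 1 : ℕ) : ℝ) = ∑ n ∈ Ioc 1 N, f n := by
    rw [Finset.sum_Ico_add' (fun j : ℕ => f (j : ℝ)) 1 N 1]
    congr 1
  have hint : ∫ u in ((1 : ℕ) : ℝ)..((N : ℕ) : ℝ), f u =
      ((N : ℝ) ^ (-(3 / 2 : ℝ) + 1) - 1 ^ (-(3 / 2 : ℝ) + 1)) / (-(3 / 2 : ℝ) + 1) := by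
    simp only [hf, Nat.cast_one]
    rw [integral_rpow (Or.inr ⟨by norm_num, ?_⟩)]
    rw [Set.uIcc_of_le (by exact_mod_cast hN.le)]
    simp only [Set.mem_Icc, not_and, not_le]
    intro h; linarith
  have hN0 : (0 : ℝ) < N := by exact_mod_cast (by omega : 0 < N)
  calc ∑ n ∈ Ioc 1 N, (n : ℝ) ^ (-(3 / 2 : ℝ)) = ∑ i ∈ Finset.Ico 1 N, f ((i + 1 : ℕ) : ℝ) := hre.symm
    _ ≤ ∫ u in ((1 : ℕ) : ℝ)..((N : ℕ) : ℝ), f u := hsum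
    _ = ((N : ℝ) ^ (-(3 / 2 : ℝ) + 1) - 1 ^ (-(3 / 2 : ℝ) + 1)) / (-(3 / 2 : ℝ) + 1) := hint
    _ = 2 - 2 * (N : ℝ) ^ (-(3 / 2 : ℝ) + 1) := by rw [Real.one_rpow]; ring
    _ ≤ 2 := by linarith [Real.rpow_nonneg hN0.le (-(3 / 2 : ℝ) + 1)]

/-- For a prime `p`: `(1 − p^{-1/2})⁻¹ p⁻¹ ≤ 1/p + 4 p^{-3/2}` (since `p^{-1/2} ≤ 2^{-1/2} ≤ 3/4`).
[folklore] -/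
theorem eulerFactor_div_le {p : ℕ} (hp : p.Prime) :
    (1 - (p : ℝ) ^ (-(1 / 2 : ℝ)))⁻¹ * (p : ℝ)⁻¹ ≤ 1 / p + 4 * (p : ℝ) ^ (-(3 / 2 : ℝ)) := by
  have hpR : (0 : ℝ) < p := by exact_mod_cast hp.pos
  have hp2 : (2 : ℝ) ≤ p := by exact_mod_cast hp.two_le
  set x : ℝ := (p : ℝ) ^ (-(1 / 2 : ℝ)) with hx
  have hx0 : 0 < x := Real.rpow_pos_of_pos hpR _
  -- `x ≤ 3/4`
  have hx34 : x ≤ 3 / 4 := by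
    have h1 : x ≤ (2 : ℝ) ^ (-(1 / 2 : ℝ)) :=
      Real.rpow_le_rpow_of_nonpos (by norm_num) hp2 (by norm_num)
    have h2 : (2 : ℝ) ^ (-(1 / 2 : ℝ)) ≤ 3 / 4 := by
      have h02 : (0 : ℝ) ≤ 2 := by norm_num
      have hsqrt : (4 : ℝ) / 3 ≤ Real.sqrt 2 := by
        rw [Real.le_sqrt' (by norm_num : (0 : ℝ) < 4 / 3)]; norm_num
      rw [Real.rpow_neg h02, ← Real.sqrt_eq_rpow]
      calc (Real.sqrt 2)⁻¹ ≤ ((4 : ℝ) / 3)⁻¹ := by gcongr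
        _ = 3 / 4 := by norm_num
    exact h1.trans h2
  have h1x : 0 < 1 - x := by linarith
  -- `(1 - x)⁻¹ ≤ 1 + 4x`
  have hinv : (1 - x)⁻¹ ≤ 1 + 4 * x := by
    rw [inv_le_iff_one_le_mul₀ h1x]
    nlinarith
  have hx32 : x * (p : ℝ)⁻¹ = (p : ℝ) ^ (-(3 / 2 : ℝ)) := by
    rw [hx, ← Real.rpow_neg_one, ← Real.rpow_add hpR]; norm_num
  calc (1 - x)⁻¹ * (p : ℝ)⁻¹ ≤ (1 + 4 * x) * (p : ℝ)⁻¹ :=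
        mul_le_mul_of_nonneg_right hinv (inv_nonneg.2 hpR.le)
    _ = 1 / p + 4 * (x * (p : ℝ)⁻¹) := by ring
    _ = 1 / p + 4 * (p : ℝ) ^ (-(3 / 2 : ℝ)) := by rw [hx32]

/-- **`∑_{e ≤ N, e squarefree} F(e)/e ≤ e^{12} log N`** for `N ≥ 2`, `F(e) = ∏_{p ∣ e}(1 − p^{-1/2})⁻¹`:
the sum of the multiplicative function `e ↦ ∏_{p ∣ e} (1 − p^{-1/2})⁻¹/p` over the divisors of
`∏_{p ≤ N} p` is `∏_{p ≤ N} (1 + (1 − p^{-1/2})⁻¹/p) ≤ exp(∑_{p ≤ N} (1/p + 4p^{-3/2}))`, and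
Mertens (`Literature.NumberTheory.LFunctions.MertensBound.sum_inv_prime_le`). [folklore] -/
theorem sum_squarefree_sqrtEulerFactor_div_le {N : ℕ} (hN : 2 ≤ N) :
    ∑ e ∈ (Ioc 0 N).filter Squarefree, sqrtEulerFactor e / e ≤ Real.exp 12 * Real.log N := by
  classical
  set g : ℕ → ℝ := fun p => (1 - (p : ℝ) ^ (-(1 / 2 : ℝ)))⁻¹ * (p : ℝ)⁻¹ with hg
  set f : ArithmeticFunction ℝ := ArithmeticFunction.prodPrimeFactors g with hf
  have hfmult : f.IsMultiplicative := ArithmeticFunction.IsMultiplicative.prodPrimeFactors g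
  have hg0 : ∀ p ∈ (Set.univ : Set ℕ), p.Prime → 0 ≤ g p := fun p _ hp =>
    mul_nonneg (inv_pos.2 (one_sub_rpow_neg_half_pos hp)).le (inv_nonneg.2 (Nat.cast_nonneg p))
  have hf0 : ∀ e, 0 ≤ f e := by
    intro e
    rcases Nat.eq_zero_or_pos e with rfl | he
    · simp [hf]
    rw [hf, ArithmeticFunction.prodPrimeFactors_apply he.ne']
    exact Finset.prod_nonneg fun p hp => hg0 p trivial (Nat.prime_of_mem_primeFactors hp)
  -- squarefree `e`: `F(e)/e = f(e)`
  have hfe : ∀ e, e ≠ 0 → Squarefree e → sqrtEulerFactor e / e = f e := by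
    intro e he hsq
    rw [hf, ArithmeticFunction.prodPrimeFactors_apply he, sqrtEulerFactor]
    rw [Finset.prod_mul_distrib, div_eq_mul_inv]
    congr 1
    rw [Finset.prod_inv_distrib, ← Nat.cast_prod, Nat.prod_primeFactors_of_squarefree hsq]
  -- the squarefree `e ≤ N` divide `P = ∏_{p ≤ N} p`
  set P := Literature.NumberTheory.Sieve.primesProdBelow ((N + 1 : ℕ) : ℝ) with hP
  have hPsq := Literature.NumberTheory.Sieve.squarefree_primesProdBelow ((N + 1 : ℕ) : ℝ)
  have hP0 := Literature.NumberTheory.Sieve.primesProdBelow_ne_zero ((N + 1 : ℕ) : ℝ)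
  have hPpf : P.primeFactors = Nat.primesLE N := by
    rw [hP, Literature.NumberTheory.Sieve.primeFactors_primesProdBelow, Nat.ceil_natCast]
    rfl
  have hsub : (Ioc 0 N).filter Squarefree ⊆ P.divisors := by
    intro e he
    rw [Finset.mem_filter, Finset.mem_Ioc] at he
    rw [Nat.mem_divisors]
    refine ⟨?_, hP0⟩
    rw [← Nat.prod_primeFactors_of_squarefree he.2]
    refine Finset.prod_primes_dvd _ (fun p hp => (Nat.prime_of_mem_primeFactors hp).prime) ?_
    intro p hp
    rw [hP, Literature.NumberTheory.Sieve.dvd_primesProdBelow_iff (Nat.prime_of_mem_primeFactors hp)]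
    have : p ≤ N := (Nat.le_of_mem_primeFactors hp).trans he.1.2
    exact_mod_cast Nat.lt_succ_of_le this
  -- main chain
  have hstep1 : ∑ e ∈ (Ioc 0 N).filter Squarefree, sqrtEulerFactor e / e =
      ∑ e ∈ (Ioc 0 N).filter Squarefree, f e := by
    refine Finset.sum_congr rfl fun e he => ?_
    rw [Finset.mem_filter, Finset.mem_Ioc] at he
    exact hfe e he.1.1.ne' he.2
  have hstep2 : ∑ e ∈ (Ioc 0 N).filter Squarefree, f e ≤ ∑ e ∈ P.divisors, f e :=
    Finset.sum_le_sum_of_subset_of_nonneg hsub fun e _ _ => hf0 e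
  have hstep3 : ∑ e ∈ P.divisors, f e = ∏ p ∈ P.primeFactors, (1 + f p) :=
    (hfmult.prodPrimeFactors_one_add_of_squarefree hPsq).symm
  have hstep4 : ∏ p ∈ P.primeFactors, (1 + f p) ≤ Real.exp (∑ p ∈ P.primeFactors, f p) := by
    rw [Real.exp_sum]
    refine Finset.prod_le_prod (fun p _ => by linarith [hf0 p]) fun p _ => ?_
    have := Real.add_one_le_exp (f p)
    linarith
  have hfp : ∀ p, p.Prime → f p = g p := by
    intro p hp
    rw [hf, ArithmeticFunction.prodPrimeFactors_apply hp.ne_zero, Nat.Prime.primeFactors hp,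
      Finset.prod_singleton]
  have hstep5 : ∑ p ∈ P.primeFactors, f p ≤ Real.log (Real.log N) + 4 + 4 * 2 := by
    rw [hPpf]
    calc ∑ p ∈ Nat.primesLE N, f p ≤ ∑ p ∈ Nat.primesLE N, (1 / (p : ℝ) + 4 * (p : ℝ) ^ (-(3 / 2 : ℝ))) := by
          refine Finset.sum_le_sum fun p hp => ?_
          have hpp := (Nat.mem_primesLE.1 hp).2
          rw [hfp p hpp]
          exact eulerFactor_div_le hpp
      _ = ∑ p ∈ Nat.primesLE N, 1 / (p : ℝ) + 4 * ∑ p ∈ Nat.primesLE N, (p : ℝ) ^ (-(3 / 2 : ℝ)) := by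
          rw [Finset.sum_add_distrib, Finset.mul_sum]
      _ ≤ Real.log (Real.log N) + 4 + 4 * 2 := by
          refine add_le_add (MertensBound.sum_inv_prime_le N hN) (mul_le_mul_of_nonneg_left ?_ (by norm_num))
          calc ∑ p ∈ Nat.primesLE N, (p : ℝ) ^ (-(3 / 2 : ℝ))
              ≤ ∑ n ∈ Ioc 1 N, (n : ℝ) ^ (-(3 / 2 : ℝ)) := by
                refine Finset.sum_le_sum_of_subset_of_nonneg (fun p hp => ?_) fun _ _ _ => by positivity
                have h := Nat.mem_primesLE.1 hp
                rw [Finset.mem_Ioc]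
                exact ⟨h.2.one_lt, h.1⟩
            _ ≤ 2 := sum_rpow_neg_three_halves_le N
  have hlogN : 0 < Real.log N := Real.log_pos (by exact_mod_cast hN)
  calc ∑ e ∈ (Ioc 0 N).filter Squarefree, sqrtEulerFactor e / e
      = ∑ e ∈ (Ioc 0 N).filter Squarefree, f e := hstep1
    _ ≤ ∏ p ∈ P.primeFactors, (1 + f p) := hstep2.trans_eq hstep3
    _ ≤ Real.exp (∑ p ∈ P.primeFactors, f p) := hstep4
    _ ≤ Real.exp (Real.log (Real.log N) + 12) := Real.exp_le_exp.2 (by linarith)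
    _ = Real.exp 12 * Real.log N := by
        rw [Real.exp_add, Real.exp_log hlogN, mul_comm]

/-! ### §7 The quadratic forms: restriction to multiples of `d`, diagonalisation, polarisation -/

/-- The divisors of the elements of `(0, N]` make up `(0, N]`. [folklore] -/
theorem biUnion_divisors_Ioc (N : ℕ) : (Ioc 0 N).biUnion Nat.divisors = Ioc 0 N := by
  ext e
  simp only [Finset.mem_biUnion, Finset.mem_Ioc, Nat.mem_divisors]
  constructor
  · rintro ⟨k, ⟨hk0, hkN⟩, hdk, hk⟩
    exact ⟨Nat.pos_of_dvd_of_pos hdk hk0, (Nat.le_of_dvd hk0 hdk).trans hkN⟩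
  · rintro ⟨he0, heN⟩
    exact ⟨e, ⟨he0, heN⟩, dvd_rfl, he0.ne'⟩

/-- **The form restricted to the multiples of `d`, diagonalised**: for `d ≥ 1` and any `x`,
`∑_{d ∣ q, d ∣ r ≤ N} x_q x_r (q,r) = d ∑_{e ≤ N/d} φ(e) (∑_{de ∣ h ≤ N} x_h)²`
(`(dq', dr') = d (q', r')`, `(q',r') = ∑_{e ∣ (q',r')} φ(e)`,
`Literature.NumberTheory.Sieve.sum_sum_mul_mul_apply_gcd`). [folklore] -/
theorem sum_sum_filter_dvd_mul_gcd_eq {d : ℕ} (hd : 0 < d) (N : ℕ) (x : ℕ → ℝ) :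
    ∑ q ∈ (Ioc 0 N).filter (d ∣ ·), ∑ r ∈ (Ioc 0 N).filter (d ∣ ·), x q * x r * (Nat.gcd q r : ℝ) =
      d * ∑ e ∈ (Ioc 0 (N / d)).biUnion Nat.divisors,
        (Nat.totient e : ℝ) * (∑ h ∈ (Ioc 0 N).filter (d * e ∣ ·), x h) ^ 2 := by
  rw [sum_filter_dvd_eq_sum hd]
  simp_rw [sum_filter_dvd_eq_sum hd N (fun r => x _ * x r * (Nat.gcd _ r : ℝ)), Nat.gcd_mul_left,
    Nat.cast_mul]
  have hS : (0 : ℕ) ∉ Ioc 0 (N / d) := by simp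
  have hF : ∀ n : ℕ, n ≠ 0 → ∑ e ∈ n.divisors, (Nat.totient e : ℝ) = (n : ℝ) := fun n _ => by
    exact_mod_cast Nat.sum_totient n
  have key := Literature.NumberTheory.Sieve.sum_sum_mul_mul_apply_gcd (Ioc 0 (N / d)) hS
    (fun k => x (d * k)) (fun e => (Nat.totient e : ℝ)) (fun g => (g : ℝ)) hF
  have hlhs : ∑ q ∈ Ioc 0 (N / d), ∑ r ∈ Ioc 0 (N / d), x (d * q) * x (d * r) * ((d : ℝ) * (Nat.gcd q r : ℝ))
      = d * ∑ q ∈ Ioc 0 (N / d), ∑ r ∈ Ioc 0 (N / d), x (d * q) * x (d * r) * (Nat.gcd q r : ℝ) := by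
    rw [Finset.mul_sum]
    refine Finset.sum_congr rfl fun q _ => ?_
    rw [Finset.mul_sum]
    refine Finset.sum_congr rfl fun r _ => ?_
    ring
  rw [hlhs, key]
  congr 1
  refine Finset.sum_congr rfl fun e he => ?_
  congr 2
  -- `∑_{k ≤ N/d, e ∣ k} x(dk) = ∑_{h ≤ N, de ∣ h} x h`
  have he0 : 0 < e := by
    rw [Finset.mem_biUnion] at he
    obtain ⟨k, hk, hek⟩ := he
    exact Nat.pos_of_mem_divisors hek
  rw [sum_filter_dvd_eq_sum he0, sum_filter_dvd_eq_sum (Nat.mul_pos hd he0), Nat.div_div_eq_div_mul]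
  refine Finset.sum_congr rfl fun j _ => ?_
  rw [mul_assoc]

/-- The restricted forms are `≥ 0`. [folklore] -/
theorem sum_sum_filter_dvd_mul_gcd_nonneg {d : ℕ} (hd : 0 < d) (N : ℕ) (x : ℕ → ℝ) :
    0 ≤ ∑ q ∈ (Ioc 0 N).filter (d ∣ ·), ∑ r ∈ (Ioc 0 N).filter (d ∣ ·), x q * x r * (Nat.gcd q r : ℝ) := by
  rw [sum_sum_filter_dvd_mul_gcd_eq hd]
  exact mul_nonneg (Nat.cast_nonneg d) (Finset.sum_nonneg fun e _ => by positivity)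

/-- **`log (q,r) = ∑_{d ∣ (q,r)} Λ(d)`: `∑_{q,r} x_q x_r (q,r) log (q,r) = ∑_{d ≤ N} Λ(d) ∑_{d∣q, d∣r} x_q x_r (q,r)`.**
[folklore] -/
theorem sum_sum_mul_gcd_mul_log_eq (N : ℕ) (x : ℕ → ℝ) :
    ∑ q ∈ Ioc 0 N, ∑ r ∈ Ioc 0 N, x q * x r * (Nat.gcd q r : ℝ) * Real.log (Nat.gcd q r) =
      ∑ d ∈ Ioc 0 N, Λ d *
        ∑ q ∈ (Ioc 0 N).filter (d ∣ ·), ∑ r ∈ (Ioc 0 N).filter (d ∣ ·), x q * x r * (Nat.gcd q r : ℝ) := by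
  -- expand `log (q,r)` and bring the `d`-sum outside
  have hexp : ∀ q ∈ Ioc 0 N, ∀ r ∈ Ioc 0 N,
      x q * x r * (Nat.gcd q r : ℝ) * Real.log (Nat.gcd q r) =
        ∑ d ∈ Ioc 0 N, if d ∣ q ∧ d ∣ r then Λ d * (x q * x r * (Nat.gcd q r : ℝ)) else 0 := by
    intro q hq r hr
    have hq0 : 0 < q := (Finset.mem_Ioc.1 hq).1
    have hg0 : Nat.gcd q r ≠ 0 := (Nat.gcd_pos_of_pos_left r hq0).ne'
    rw [← ArithmeticFunction.vonMangoldt_sum, Finset.mul_sum, ← Finset.sum_filter]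
    have hset : (Nat.gcd q r).divisors = (Ioc 0 N).filter (fun d => d ∣ q ∧ d ∣ r) := by
      ext d
      rw [Nat.mem_divisors, Finset.mem_filter, Finset.mem_Ioc, Nat.dvd_gcd_iff]
      constructor
      · rintro ⟨⟨hdq, hdr⟩, -⟩
        exact ⟨⟨Nat.pos_of_dvd_of_pos hdq hq0, (Nat.le_of_dvd hq0 hdq).trans (Finset.mem_Ioc.1 hq).2⟩,
          hdq, hdr⟩
      · rintro ⟨-, hdq, hdr⟩
        exact ⟨⟨hdq, hdr⟩, hg0⟩
    rw [hset]
    refine Finset.sum_congr rfl fun d _ => by ring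
  rw [Finset.sum_congr rfl fun q hq => Finset.sum_congr rfl fun r hr => hexp q hq r hr]
  set T : ℕ → ℕ → ℕ → ℝ := fun d q r =>
    if d ∣ q ∧ d ∣ r then Λ d * (x q * x r * (Nat.gcd q r : ℝ)) else 0 with hT
  calc ∑ q ∈ Ioc 0 N, ∑ r ∈ Ioc 0 N, ∑ d ∈ Ioc 0 N, T d q r
      = ∑ q ∈ Ioc 0 N, ∑ d ∈ Ioc 0 N, ∑ r ∈ Ioc 0 N, T d q r :=
        Finset.sum_congr rfl fun q _ => Finset.sum_comm
    _ = ∑ d ∈ Ioc 0 N, ∑ q ∈ Ioc 0 N, ∑ r ∈ Ioc 0 N, T d q r := Finset.sum_comm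
    _ = _ := by
        refine Finset.sum_congr rfl fun d _ => ?_
        rw [Finset.sum_filter, Finset.mul_sum]
        refine Finset.sum_congr rfl fun q _ => ?_
        rw [Finset.sum_filter]
        by_cases h1 : d ∣ q
        · rw [if_pos h1, Finset.mul_sum]
          refine Finset.sum_congr rfl fun r _ => ?_
          simp only [hT]
          by_cases h2 : d ∣ r
          · rw [if_pos ⟨h1, h2⟩, if_pos h2]
          · rw [if_neg (fun h => h2 h.2), if_neg h2, mul_zero]
        · rw [if_neg h1, mul_zero]
          refine Finset.sum_eq_zero fun r _ => ?_
          simp only [hT]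
          rw [if_neg (fun h => h1 h.1)]

/-- **Polarisation**: the symmetric bilinear form of the weights `(q,r)` diagonalises as
`∑_{q,r} u_q v_r (q,r) = ∑_{e} φ(e) (∑_{e ∣ q} u_q)(∑_{e ∣ r} v_r)`. [folklore] -/
theorem sum_sum_mul_gcd_bilinear_eq (N : ℕ) (u v : ℕ → ℝ) :
    ∑ q ∈ Ioc 0 N, ∑ r ∈ Ioc 0 N, u q * v r * (Nat.gcd q r : ℝ) =
      ∑ e ∈ Ioc 0 N, (Nat.totient e : ℝ) *
        ((∑ q ∈ (Ioc 0 N).filter (e ∣ ·), u q) * (∑ r ∈ (Ioc 0 N).filter (e ∣ ·), v r)) := by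
  have hS : (0 : ℕ) ∉ Ioc 0 N := by simp
  have hF : ∀ n : ℕ, n ≠ 0 → ∑ e ∈ n.divisors, (Nat.totient e : ℝ) = (n : ℝ) := fun n _ => by
    exact_mod_cast Nat.sum_totient n
  have hplus := Literature.NumberTheory.Sieve.sum_sum_mul_mul_apply_gcd (Ioc 0 N) hS
    (fun k => u k + v k) (fun e => (Nat.totient e : ℝ)) (fun g => (g : ℝ)) hF
  have hminus := Literature.NumberTheory.Sieve.sum_sum_mul_mul_apply_gcd (Ioc 0 N) hS
    (fun k => u k - v k) (fun e => (Nat.totient e : ℝ)) (fun g => (g : ℝ)) hF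
  rw [biUnion_divisors_Ioc] at hplus hminus
  -- symmetry of the bilinear form
  have hsymm : ∑ q ∈ Ioc 0 N, ∑ r ∈ Ioc 0 N, v q * u r * (Nat.gcd q r : ℝ) =
      ∑ q ∈ Ioc 0 N, ∑ r ∈ Ioc 0 N, u q * v r * (Nat.gcd q r : ℝ) := by
    rw [Finset.sum_comm]
    refine Finset.sum_congr rfl fun q _ => Finset.sum_congr rfl fun r _ => ?_
    rw [Nat.gcd_comm]; ring
  -- `Q(u+v) − Q(u−v) = 4 B(u,v)` on both sides
  have hL : ∑ q ∈ Ioc 0 N, ∑ r ∈ Ioc 0 N, (u q + v q) * (u r + v r) * (Nat.gcd q r : ℝ) -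
      ∑ q ∈ Ioc 0 N, ∑ r ∈ Ioc 0 N, (u q - v q) * (u r - v r) * (Nat.gcd q r : ℝ) =
      4 * ∑ q ∈ Ioc 0 N, ∑ r ∈ Ioc 0 N, u q * v r * (Nat.gcd q r : ℝ) := by
    have h1 : ∑ q ∈ Ioc 0 N, ∑ r ∈ Ioc 0 N, (u q + v q) * (u r + v r) * (Nat.gcd q r : ℝ) -
        ∑ q ∈ Ioc 0 N, ∑ r ∈ Ioc 0 N, (u q - v q) * (u r - v r) * (Nat.gcd q r : ℝ) =
        2 * ∑ q ∈ Ioc 0 N, ∑ r ∈ Ioc 0 N, u q * v r * (Nat.gcd q r : ℝ) +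
          2 * ∑ q ∈ Ioc 0 N, ∑ r ∈ Ioc 0 N, v q * u r * (Nat.gcd q r : ℝ) := by
      rw [Finset.mul_sum, Finset.mul_sum, ← Finset.sum_add_distrib, ← Finset.sum_sub_distrib]
      refine Finset.sum_congr rfl fun q _ => ?_
      rw [Finset.mul_sum, Finset.mul_sum, ← Finset.sum_add_distrib, ← Finset.sum_sub_distrib]
      refine Finset.sum_congr rfl fun r _ => ?_
      ring
    rw [h1, hsymm]; ring
  have hR : ∑ e ∈ Ioc 0 N, (Nat.totient e : ℝ) * (∑ h ∈ (Ioc 0 N).filter (e ∣ ·), (u h + v h)) ^ 2 -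
      ∑ e ∈ Ioc 0 N, (Nat.totient e : ℝ) * (∑ h ∈ (Ioc 0 N).filter (e ∣ ·), (u h - v h)) ^ 2 =
      4 * ∑ e ∈ Ioc 0 N, (Nat.totient e : ℝ) *
        ((∑ q ∈ (Ioc 0 N).filter (e ∣ ·), u q) * (∑ r ∈ (Ioc 0 N).filter (e ∣ ·), v r)) := by
    rw [Finset.mul_sum, ← Finset.sum_sub_distrib]
    refine Finset.sum_congr rfl fun e _ => ?_
    rw [Finset.sum_add_distrib, Finset.sum_sub_distrib]
    ring
  have h4 : (4 : ℝ) * ∑ q ∈ Ioc 0 N, ∑ r ∈ Ioc 0 N, u q * v r * (Nat.gcd q r : ℝ) =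
      4 * ∑ e ∈ Ioc 0 N, (Nat.totient e : ℝ) *
        ((∑ q ∈ (Ioc 0 N).filter (e ∣ ·), u q) * (∑ r ∈ (Ioc 0 N).filter (e ∣ ·), v r)) := by
    rw [← hL, ← hR, hplus, hminus]
  linarith

/-! ### §8 The three quadratic forms of the plateau mollifier -/

/-- `log X ≥ 1` and the size facts for `X ≥ 3`, `N = ⌊X⌋`. [folklore] -/
theorem basic_of_three_le {X : ℝ} (hX : 3 ≤ X) :
    1 < X ∧ 1 ≤ Real.log X ∧ 2 ≤ ⌊X⌋₊ ∧ 0 ≤ Real.log ⌊X⌋₊ ∧ Real.log ⌊X⌋₊ ≤ Real.log X := by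
  have hX1 : 1 < X := by linarith
  have hL : 1 ≤ Real.log X := by
    rw [Real.le_log_iff_exp_le (by linarith)]
    have := Real.exp_one_lt_d9
    linarith
  have hN : 2 ≤ ⌊X⌋₊ := Nat.le_floor (by norm_num; linarith)
  have hN0 : (0 : ℝ) < ⌊X⌋₊ := by exact_mod_cast (by omega : 0 < ⌊X⌋₊)
  refine ⟨hX1, hL, hN, Real.log_natCast_nonneg _, Real.log_le_log hN0 (Nat.floor_le (by linarith))⟩

/-- **The diagonal sums**: for `d ≥ 1`,
`∑_{e ≤ N/d} φ(e) y_{de}² ≤ (4K₁²(7 + 12 log N)/log²X) / φ(d)²`, using `|y_{de}| ≤ 2K₁/(φ(de) log X)`,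
`φ(de) ≥ φ(d)φ(e)` and `∑_{e ≤ N} 1/φ(e) ≤ 7 + 12 log N`
(`Literature.NumberTheory.LFunctions.Montgomery.sum_Icc_inv_totient_le`). [folklore] -/
theorem diag_le {X : ℝ} (hX : 1 < X) {K₁ : ℝ} (hK₁ : ∀ J, ∑ j ∈ Ioc 0 J, |moebiusInvSum j| / j ≤ K₁)
    {d : ℕ} (hd : 0 < d) :
    ∑ e ∈ Ioc 0 (⌊X⌋₊ / d), (Nat.totient e : ℝ) *
        (∑ h ∈ (Ioc 0 ⌊X⌋₊).filter (d * e ∣ ·), weight X h / h) ^ 2 ≤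
      4 * K₁ ^ 2 * (7 + 12 * Real.log ⌊X⌋₊) / Real.log X ^ 2 / (Nat.totient d : ℝ) ^ 2 := by
  set N := ⌊X⌋₊ with hN
  have hL : 0 < Real.log X := Real.log_pos hX
  have hφd : (0 : ℝ) < Nat.totient d := by exact_mod_cast Nat.totient_pos.2 hd
  have hterm : ∀ e ∈ Ioc 0 (N / d), (Nat.totient e : ℝ) *
      (∑ h ∈ (Ioc 0 N).filter (d * e ∣ ·), weight X h / h) ^ 2 ≤
      4 * K₁ ^ 2 / (Real.log X ^ 2 * (Nat.totient d : ℝ) ^ 2) * (1 / (Nat.totient e : ℝ)) := by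
    intro e he
    have he0 : 0 < e := (Finset.mem_Ioc.1 he).1
    have hφe : (0 : ℝ) < Nat.totient e := by exact_mod_cast Nat.totient_pos.2 he0
    have hφde : (0 : ℝ) < Nat.totient (d * e) := by exact_mod_cast Nat.totient_pos.2 (Nat.mul_pos hd he0)
    have hy := abs_ySum_le hX (Nat.mul_pos hd he0) hK₁
    have hsuper : (Nat.totient d : ℝ) * Nat.totient e ≤ Nat.totient (d * e) := by
      exact_mod_cast Nat.totient_super_multiplicative d e
    have hy' : |∑ h ∈ (Ioc 0 N).filter (d * e ∣ ·), weight X h / h| ≤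
        2 * K₁ / ((Nat.totient d : ℝ) * Nat.totient e * Real.log X) := by
      refine hy.trans (div_le_div_of_nonneg_left ?_ (by positivity) ?_)
      · have : 0 ≤ K₁ := le_trans (by simp) (hK₁ 0)
        positivity
      · exact mul_le_mul_of_nonneg_right hsuper hL.le
    have hsq : (∑ h ∈ (Ioc 0 N).filter (d * e ∣ ·), weight X h / h) ^ 2 ≤
        (2 * K₁ / ((Nat.totient d : ℝ) * Nat.totient e * Real.log X)) ^ 2 := by
      rw [← sq_abs]
      exact pow_le_pow_left₀ (abs_nonneg _) hy' 2
    calc (Nat.totient e : ℝ) * (∑ h ∈ (Ioc 0 N).filter (d * e ∣ ·), weight X h / h) ^ 2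
        ≤ (Nat.totient e : ℝ) * (2 * K₁ / ((Nat.totient d : ℝ) * Nat.totient e * Real.log X)) ^ 2 :=
          mul_le_mul_of_nonneg_left hsq hφe.le
      _ = 4 * K₁ ^ 2 / (Real.log X ^ 2 * (Nat.totient d : ℝ) ^ 2) * (1 / (Nat.totient e : ℝ)) := by
          field_simp
          ring
  refine (Finset.sum_le_sum hterm).trans ?_
  rw [← Finset.mul_sum]
  have hφsum : ∑ e ∈ Ioc 0 (N / d), 1 / (Nat.totient e : ℝ) ≤ 7 + 12 * Real.log N := by
    rw [← Finset.Icc_add_one_left_eq_Ioc]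
    refine (Montgomery.sum_Icc_inv_totient_le (N / d)).trans ?_
    have h1 : Real.log ((N / d : ℕ) : ℝ) ≤ Real.log N := by
      rcases Nat.eq_zero_or_pos (N / d) with h0 | hpos
      · rw [h0, Nat.cast_zero, Real.log_zero]; exact Real.log_natCast_nonneg N
      · exact Real.log_le_log (by exact_mod_cast hpos) (by exact_mod_cast Nat.div_le_self N d)
    linarith
  have hlogN : 0 ≤ 7 + 12 * Real.log (N : ℝ) := by
    have := Real.log_natCast_nonneg N; linarith
  have hK : 0 ≤ 4 * K₁ ^ 2 / (Real.log X ^ 2 * (Nat.totient d : ℝ) ^ 2) := by positivity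
  calc 4 * K₁ ^ 2 / (Real.log X ^ 2 * (Nat.totient d : ℝ) ^ 2) * ∑ e ∈ Ioc 0 (N / d), 1 / (Nat.totient e : ℝ)
      ≤ 4 * K₁ ^ 2 / (Real.log X ^ 2 * (Nat.totient d : ℝ) ^ 2) * (7 + 12 * Real.log N) :=
        mul_le_mul_of_nonneg_left hφsum hK
    _ = 4 * K₁ ^ 2 * (7 + 12 * Real.log N) / Real.log X ^ 2 / (Nat.totient d : ℝ) ^ 2 := by
        field_simp

/-- The form restricted to multiples of a non-squarefree `d` vanishes (`b_q = 0` for `d ∣ q`).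
[folklore] -/
theorem restricted_eq_zero_of_not_squarefree (X : ℝ) (N : ℕ) {d : ℕ} (hd : ¬Squarefree d) :
    ∑ q ∈ (Ioc 0 N).filter (d ∣ ·), ∑ r ∈ (Ioc 0 N).filter (d ∣ ·),
      weight X q / q * (weight X r / r) * (Nat.gcd q r : ℝ) = 0 := by
  refine Finset.sum_eq_zero fun q hq => Finset.sum_eq_zero fun r _ => ?_
  have hdq : d ∣ q := (Finset.mem_filter.1 hq).2
  have hq : ¬Squarefree q := fun h => hd (h.squarefree_of_dvd hdq)
  rw [weight_eq_zero_of_not_squarefree X hq]; simp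

/-- **`Q₁ ≤ C₁/log X`.** The mollifier quadratic form
`Q₁ = ∑_{q,r ≤ X} b_q b_r (q,r)/(qr)` of the plateau weights is `≥ 0` and `≤ C₁ / log X` for
`X ≥ 3`, with an absolute `C₁` (main term `(log(T/2π) + 2γ) Q₁ = O(log T/log X)` of Titchmarsh §9.24).
[cite: Titchmarsh1986, §9.24] -/
theorem quadForm_le : ∃ C₁ : ℝ, ∀ X : ℝ, 3 ≤ X →
    0 ≤ ∑ q ∈ Finset.Icc 1 ⌊X⌋₊, ∑ r ∈ Finset.Icc 1 ⌊X⌋₊,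
        weight X q * weight X r * (Nat.gcd q r : ℝ) / ((q : ℝ) * r) ∧
    ∑ q ∈ Finset.Icc 1 ⌊X⌋₊, ∑ r ∈ Finset.Icc 1 ⌊X⌋₊,
        weight X q * weight X r * (Nat.gcd q r : ℝ) / ((q : ℝ) * r) ≤ C₁ / Real.log X := by
  obtain ⟨K₀, K₁, K₃, -, hK₁1, -, -, -, hK₁, -⟩ := exists_moebius_bounds
  refine ⟨76 * K₁ ^ 2, fun X hX => ?_⟩
  obtain ⟨hX1, hL1, hN2, hlogN0, hlogNX⟩ := basic_of_three_le hX
  set N := ⌊X⌋₊ with hN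
  have hL : 0 < Real.log X := by linarith
  -- rewrite as the form of `x_q = b_q/q` restricted to multiples of `1`
  have hform : ∑ q ∈ Finset.Icc 1 N, ∑ r ∈ Finset.Icc 1 N,
      weight X q * weight X r * (Nat.gcd q r : ℝ) / ((q : ℝ) * r) =
      ∑ q ∈ (Ioc 0 N).filter (1 ∣ ·), ∑ r ∈ (Ioc 0 N).filter (1 ∣ ·),
        weight X q / q * (weight X r / r) * (Nat.gcd q r : ℝ) := by
    rw [Finset.filter_true_of_mem fun q _ => one_dvd q, ← Finset.Icc_add_one_left_eq_Ioc]
    refine Finset.sum_congr rfl fun q _ => Finset.sum_congr rfl fun r _ => ?_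
    ring
  rw [hform]
  refine ⟨sum_sum_filter_dvd_mul_gcd_nonneg one_pos N _, ?_⟩
  rw [sum_sum_filter_dvd_mul_gcd_eq one_pos, Nat.cast_one, one_mul, Nat.div_one, biUnion_divisors_Ioc]
  simp_rw [one_mul]
  have hdiag := diag_le hX1 hK₁ one_pos
  simp only [Nat.div_one, one_mul, Nat.totient_one, Nat.cast_one, one_pow, div_one] at hdiag
  refine hdiag.trans ?_
  -- `4K₁²(7 + 12 log N)/log²X ≤ 76 K₁²/log X`
  have h19 : 7 + 12 * Real.log (N : ℝ) ≤ 19 * Real.log X := by linarith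
  rw [div_le_div_iff₀ (by positivity) hL]
  have hK0 : 0 ≤ K₁ ^ 2 := sq_nonneg _
  nlinarith [mul_le_mul_of_nonneg_left h19 (by positivity : 0 ≤ 4 * K₁ ^ 2 * Real.log X)]

/-- **`0 ≤ Q₃ ≤ C₃`.** The form `Q₃ = ∑_{q,r ≤ X} b_q b_r (q,r) log((q,r))/(qr)` of the plateau weights
is `≥ 0` and bounded for `X ≥ 3` (Titchmarsh §9.24: "`∑∑ δ_q δ_r (q,r) log (q,r) ≤ 2 log X {∑ μ²/φ}⁻¹`"
for Selberg's weights; here via `log g = ∑_{d ∣ g} Λ(d)` and the forms restricted to the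
multiples of the primes `p`, each `≪ (log p)/(p log X)`). [cite: Titchmarsh1986, §9.24] -/
theorem quadForm_logGcd_le : ∃ C₃ : ℝ, ∀ X : ℝ, 3 ≤ X →
    0 ≤ ∑ q ∈ Finset.Icc 1 ⌊X⌋₊, ∑ r ∈ Finset.Icc 1 ⌊X⌋₊,
        weight X q * weight X r * (Nat.gcd q r : ℝ) * Real.log (Nat.gcd q r) / ((q : ℝ) * r) ∧
    ∑ q ∈ Finset.Icc 1 ⌊X⌋₊, ∑ r ∈ Finset.Icc 1 ⌊X⌋₊,
        weight X q * weight X r * (Nat.gcd q r : ℝ) * Real.log (Nat.gcd q r) / ((q : ℝ) * r) ≤ C₃ := by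
  obtain ⟨K₀, K₁, K₃, -, hK₁1, -, -, -, hK₁, -⟩ := exists_moebius_bounds
  refine ⟨912 * K₁ ^ 2, fun X hX => ?_⟩
  obtain ⟨hX1, hL1, hN2, hlogN0, hlogNX⟩ := basic_of_three_le hX
  set N := ⌊X⌋₊ with hN
  have hL : 0 < Real.log X := by linarith
  set x : ℕ → ℝ := fun q => weight X q / q with hx
  have hform : ∑ q ∈ Finset.Icc 1 N, ∑ r ∈ Finset.Icc 1 N,
      weight X q * weight X r * (Nat.gcd q r : ℝ) * Real.log (Nat.gcd q r) / ((q : ℝ) * r) =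
      ∑ q ∈ Ioc 0 N, ∑ r ∈ Ioc 0 N, x q * x r * (Nat.gcd q r : ℝ) * Real.log (Nat.gcd q r) := by
    rw [← Finset.Icc_add_one_left_eq_Ioc]
    refine Finset.sum_congr rfl fun q _ => Finset.sum_congr rfl fun r _ => ?_
    simp only [hx]; ring
  rw [hform, sum_sum_mul_gcd_mul_log_eq]
  -- the restricted forms `R(d)` and their bounds
  set R : ℕ → ℝ := fun d => ∑ q ∈ (Ioc 0 N).filter (d ∣ ·), ∑ r ∈ (Ioc 0 N).filter (d ∣ ·),
    x q * x r * (Nat.gcd q r : ℝ) with hR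
  have hR0 : ∀ d ∈ Ioc 0 N, 0 ≤ R d := fun d hd =>
    sum_sum_filter_dvd_mul_gcd_nonneg (Finset.mem_Ioc.1 hd).1 N x
  set A : ℝ := 4 * K₁ ^ 2 * (7 + 12 * Real.log (N : ℝ)) / Real.log X ^ 2 with hA
  have hA0 : 0 ≤ A := by
    rw [hA]; have : 0 ≤ 7 + 12 * Real.log (N : ℝ) := by linarith
    positivity
  have hRprime : ∀ p : ℕ, p.Prime → p ≤ N → R p ≤ 4 / p * A := by
    intro p hp hpN
    have hp0 : 0 < p := hp.pos
    have hpR : (0 : ℝ) < p := by exact_mod_cast hp0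
    have hRp : R p = p * ∑ e ∈ Ioc 0 (N / p), (Nat.totient e : ℝ) *
        (∑ h ∈ (Ioc 0 N).filter (p * e ∣ ·), x h) ^ 2 := by
      rw [hR]
      simp only
      rw [sum_sum_filter_dvd_mul_gcd_eq hp0, biUnion_divisors_Ioc]
    have hd := diag_le hX1 hK₁ hp0
    rw [hRp]
    have hφ : (Nat.totient p : ℝ) = p - 1 := by
      rw [Nat.totient_prime hp]; push_cast [hp.one_le]; ring
    have hp2 : (2 : ℝ) ≤ p := by exact_mod_cast hp.two_le
    calc (p : ℝ) * ∑ e ∈ Ioc 0 (N / p), (Nat.totient e : ℝ) *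
          (∑ h ∈ (Ioc 0 N).filter (p * e ∣ ·), x h) ^ 2
        ≤ p * (A / (Nat.totient p : ℝ) ^ 2) := mul_le_mul_of_nonneg_left hd hpR.le
      _ ≤ 4 / p * A := by
          rw [hφ]
          -- `p/(p-1)² ≤ 4/p`
          have h1 : (0 : ℝ) < ((p : ℝ) - 1) ^ 2 := by nlinarith
          have key : (p : ℝ) / ((p : ℝ) - 1) ^ 2 ≤ 4 / p := by
            rw [div_le_div_iff₀ h1 hpR]; nlinarith
          calc (p : ℝ) * (A / ((p : ℝ) - 1) ^ 2) = (p : ℝ) / ((p : ℝ) - 1) ^ 2 * A := by ring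
            _ ≤ 4 / p * A := mul_le_mul_of_nonneg_right key hA0
  -- termwise bound `Λ(d) R(d) ≤ 4A · [d prime] log d / d`
  have hterm : ∀ d ∈ Ioc 0 N, Λ d * R d ≤ 4 * A * (if d.Prime then Real.log d / d else 0) := by
    intro d hd
    have hdN : d ≤ N := (Finset.mem_Ioc.1 hd).2
    by_cases hp : d.Prime
    · rw [if_pos hp, ArithmeticFunction.vonMangoldt_apply_prime hp]
      have hdR : (0 : ℝ) < d := by exact_mod_cast hp.pos
      calc Real.log d * R d ≤ Real.log d * (4 / d * A) :=
            mul_le_mul_of_nonneg_left (hRprime d hp hdN) (Real.log_nonneg (by exact_mod_cast hp.one_le))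
        _ = 4 * A * (Real.log d / d) := by field_simp
    · rw [if_neg hp, mul_zero]
      by_cases hΛ : Λ d = 0
      · rw [hΛ, zero_mul]
      · -- `d` is a prime power `p^k`, `k ≥ 2`, so `b_q = 0` for `d ∣ q` and `R d = 0`
        have hpp : IsPrimePow d := by
          by_contra h; exact hΛ (ArithmeticFunction.vonMangoldt_eq_zero_iff.2 h)
        obtain ⟨p, k, hpk, hk, rfl⟩ := (isPrimePow_nat_iff d).1 hpp
        have hk2 : 2 ≤ k := by
          by_contra h; have : k = 1 := by omega
          subst this; exact hp (by simpa using hpk)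
        have hnsq : ¬Squarefree (p ^ k) := by
          intro hsq
          have h2 : p * p ∣ p ^ k := by rw [← sq]; exact pow_dvd_pow p hk2
          exact hpk.not_isUnit (hsq p h2)
        have : R (p ^ k) = 0 := by
          rw [hR]; exact restricted_eq_zero_of_not_squarefree X N hnsq
        rw [this, mul_zero]
  refine ⟨Finset.sum_nonneg fun d hd => mul_nonneg ArithmeticFunction.vonMangoldt_nonneg (hR0 d hd), ?_⟩
  refine (Finset.sum_le_sum hterm).trans ?_
  rw [← Finset.mul_sum, ← Finset.sum_filter]
  have hprimes : (Ioc 0 N).filter Nat.Prime = Nat.primesLE N := by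
    ext p
    rw [Finset.mem_filter, Finset.mem_Ioc, Nat.mem_primesLE]
    constructor
    · rintro ⟨⟨-, hpN⟩, hp⟩; exact ⟨hpN, hp⟩
    · rintro ⟨hpN, hp⟩; exact ⟨⟨hp.pos, hpN⟩, hp⟩
  rw [hprimes]
  have hM := MertensBound.sum_log_div_prime_le N
  have hlog4 : Real.log 4 ≤ 2 := by
    have : Real.log 4 = 2 * Real.log 2 := by
      rw [show (4 : ℝ) = 2 ^ 2 by norm_num, Real.log_pow]; norm_num
    rw [this]; have := Real.log_two_lt_d9; linarith
  calc 4 * A * ∑ p ∈ Nat.primesLE N, Real.log p / p ≤ 4 * A * (Real.log N + Real.log 4) :=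
        mul_le_mul_of_nonneg_left hM (by positivity)
    _ ≤ 4 * A * (3 * Real.log X) := mul_le_mul_of_nonneg_left (by linarith) (by positivity)
    _ = 12 * (4 * K₁ ^ 2 * (7 + 12 * Real.log (N : ℝ))) / Real.log X := by
        rw [hA]; field_simp; norm_num
    _ ≤ 12 * (4 * K₁ ^ 2 * (19 * Real.log X)) / Real.log X := by
        refine div_le_div_of_nonneg_right ?_ hL.le
        have : 7 + 12 * Real.log (N : ℝ) ≤ 19 * Real.log X := by linarith
        have hK : 0 ≤ K₁ ^ 2 := sq_nonneg _
        nlinarith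
    _ = 912 * K₁ ^ 2 := by field_simp; ring

/-- **`|Q₂| ≤ C₂`.** The form `Q₂ = ∑_{q,r ≤ X} b_q b_r (q,r) log q/(qr)` of the plateau weights is
bounded for `X ≥ 3` (Titchmarsh §9.24: `∑∑ δ_q δ_r (q,r) log q = 0` for Selberg's weights; for the
plateau weights it is `O(1)` via `ỹ_l = (log l) y_l + O((1 + log N)(F(l) + l/φ(l))/(l log X))`).
[cite: Titchmarsh1986, §9.24] -/
theorem abs_quadForm_log_le : ∃ C₂ : ℝ, ∀ X : ℝ, 3 ≤ X →
    |∑ q ∈ Finset.Icc 1 ⌊X⌋₊, ∑ r ∈ Finset.Icc 1 ⌊X⌋₊,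
        weight X q * weight X r * (Nat.gcd q r : ℝ) * Real.log q / ((q : ℝ) * r)| ≤ C₂ := by
  obtain ⟨K₀, K₁, K₃, hK₀1, hK₁1, hK₃1, hK₀, -, hK₁, hK₃⟩ := exists_moebius_bounds
  refine ⟨8 * K₁ * (2 * K₀ * Real.exp 12 + 19 * K₃) + 76 * K₁ ^ 2, fun X hX => ?_⟩
  obtain ⟨hX1, hL1, hN2, hlogN0, hlogNX⟩ := basic_of_three_le hX
  set N := ⌊X⌋₊ with hN
  have hL : 0 < Real.log X := by linarith
  set u : ℕ → ℝ := fun q => weight X q * Real.log q / q with hu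
  set v : ℕ → ℝ := fun q => weight X q / q with hv
  have hform : ∑ q ∈ Finset.Icc 1 N, ∑ r ∈ Finset.Icc 1 N,
      weight X q * weight X r * (Nat.gcd q r : ℝ) * Real.log q / ((q : ℝ) * r) =
      ∑ q ∈ Ioc 0 N, ∑ r ∈ Ioc 0 N, u q * v r * (Nat.gcd q r : ℝ) := by
    rw [← Finset.Icc_add_one_left_eq_Ioc]
    refine Finset.sum_congr rfl fun q _ => Finset.sum_congr rfl fun r _ => ?_
    simp only [hu, hv]; ring
  rw [hform, sum_sum_mul_gcd_bilinear_eq]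
  -- `ỹ_e`, `y_e` and their bounds
  set yt : ℕ → ℝ := fun e => ∑ q ∈ (Ioc 0 N).filter (e ∣ ·), u q with hyt
  set y : ℕ → ℝ := fun e => ∑ r ∈ (Ioc 0 N).filter (e ∣ ·), v r with hy
  set rest : ℕ → ℝ := fun e => 2 * (1 + Real.log (N : ℝ)) / ((e : ℝ) * Real.log X) *
    (K₀ * (2 * sqrtEulerFactor e) + K₃ * ((e : ℝ) / Nat.totient e)) with hrest
  have hy0 : ∀ e, ¬Squarefree e → y e = 0 := by
    intro e he
    simp only [hy, hv]
    refine Finset.sum_eq_zero fun r hr => ?_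
    have hdq : e ∣ r := (Finset.mem_filter.1 hr).2
    have hr' : ¬Squarefree r := fun h => he (h.squarefree_of_dvd hdq)
    rw [weight_eq_zero_of_not_squarefree X hr', zero_div]
  have hybound : ∀ e, 0 < e → |y e| ≤ 2 * K₁ / ((Nat.totient e : ℝ) * Real.log X) := fun e he => by
    simp only [hy, hv]; exact abs_ySum_le hX1 he hK₁
  have hytbound : ∀ e, 0 < e → |yt e - Real.log e * y e| ≤ rest e := fun e he => by
    simp only [hyt, hy, hu, hv, hrest]; exact abs_ytildeSum_sub_le hX1 he hK₀ hK₃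
  -- termwise
  have hterm : ∀ e ∈ Ioc 0 N, |(Nat.totient e : ℝ) * (yt e * y e)| ≤
      (if Squarefree e then 2 * K₁ / Real.log X * rest e else 0) +
        Real.log N * ((Nat.totient e : ℝ) * y e ^ 2) := by
    intro e he
    have he0 : 0 < e := (Finset.mem_Ioc.1 he).1
    have heN : e ≤ N := (Finset.mem_Ioc.1 he).2
    have hφ : (0 : ℝ) < Nat.totient e := by exact_mod_cast Nat.totient_pos.2 he0
    by_cases hsq : Squarefree e
    · rw [if_pos hsq]
      have hloge : Real.log e ≤ Real.log N :=
        Real.log_le_log (by exact_mod_cast he0) (by exact_mod_cast heN)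
      have hloge0 : 0 ≤ Real.log e := Real.log_natCast_nonneg e
      have h1 : |yt e| ≤ rest e + Real.log e * |y e| := by
        have := hytbound e he0
        have h2 : |yt e| ≤ |yt e - Real.log e * y e| + |Real.log e * y e| := by
          have := abs_add_le (yt e - Real.log e * y e) (Real.log e * y e)
          rwa [sub_add_cancel] at this
        rw [abs_mul, abs_of_nonneg hloge0] at h2
        linarith
      have hrest0 : 0 ≤ rest e := (abs_nonneg _).trans (hytbound e he0)
      rw [abs_mul, abs_of_pos hφ, abs_mul]
      calc (Nat.totient e : ℝ) * (|yt e| * |y e|)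
          ≤ (Nat.totient e : ℝ) * ((rest e + Real.log e * |y e|) * |y e|) := by
            exact mul_le_mul_of_nonneg_left (mul_le_mul_of_nonneg_right h1 (abs_nonneg _)) hφ.le
        _ = rest e * ((Nat.totient e : ℝ) * |y e|) + Real.log e * ((Nat.totient e : ℝ) * |y e| ^ 2) := by
            ring
        _ ≤ rest e * (2 * K₁ / Real.log X) + Real.log N * ((Nat.totient e : ℝ) * |y e| ^ 2) := by
            refine add_le_add (mul_le_mul_of_nonneg_left ?_ hrest0)
              (mul_le_mul_of_nonneg_right hloge (by positivity))
            calc (Nat.totient e : ℝ) * |y e| ≤ (Nat.totient e : ℝ) * (2 * K₁ / ((Nat.totient e : ℝ) * Real.log X)) :=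
                  mul_le_mul_of_nonneg_left (hybound e he0) hφ.le
              _ = 2 * K₁ / Real.log X := by field_simp
        _ = 2 * K₁ / Real.log X * rest e + Real.log N * ((Nat.totient e : ℝ) * y e ^ 2) := by
            rw [sq_abs]; ring
    · rw [if_neg hsq, hy0 e hsq]
      simp
  refine (Finset.abs_sum_le_sum_abs _ _).trans ((Finset.sum_le_sum hterm).trans ?_)
  rw [Finset.sum_add_distrib, ← Finset.sum_filter, ← Finset.mul_sum, ← Finset.mul_sum]
  -- the diagonal part
  have hdiag : ∑ e ∈ Ioc 0 N, (Nat.totient e : ℝ) * y e ^ 2 ≤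
      4 * K₁ ^ 2 * (7 + 12 * Real.log (N : ℝ)) / Real.log X ^ 2 := by
    have hd := diag_le hX1 hK₁ one_pos
    simp only [Nat.div_one, one_mul, Nat.totient_one, Nat.cast_one, one_pow, div_one] at hd
    exact hd
  -- the `rest` part
  have hrestsum : ∑ e ∈ (Ioc 0 N).filter Squarefree, rest e ≤
      2 * (1 + Real.log (N : ℝ)) / Real.log X *
        (2 * K₀ * (Real.exp 12 * Real.log N) + K₃ * (7 + 12 * Real.log N)) := by
    have hsplit : ∀ e ∈ (Ioc 0 N).filter Squarefree, rest e =
        2 * (1 + Real.log (N : ℝ)) / Real.log X *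
          (2 * K₀ * (sqrtEulerFactor e / e) + K₃ * (1 / (Nat.totient e : ℝ))) := by
      intro e he
      have he0 : (0 : ℝ) < e := by exact_mod_cast (Finset.mem_Ioc.1 (Finset.mem_filter.1 he).1).1
      simp only [hrest]
      field_simp
    rw [Finset.sum_congr rfl hsplit, ← Finset.mul_sum, Finset.sum_add_distrib, ← Finset.mul_sum,
      ← Finset.mul_sum]
    have hlogN1 : 0 ≤ 2 * (1 + Real.log (N : ℝ)) / Real.log X := by positivity
    refine mul_le_mul_of_nonneg_left (add_le_add ?_ ?_) hlogN1
    · exact mul_le_mul_of_nonneg_left (sum_squarefree_sqrtEulerFactor_div_le hN2) (by linarith)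
    · refine mul_le_mul_of_nonneg_left ?_ (by linarith)
      calc ∑ e ∈ (Ioc 0 N).filter Squarefree, 1 / (Nat.totient e : ℝ)
          ≤ ∑ e ∈ Ioc 0 N, 1 / (Nat.totient e : ℝ) :=
            Finset.sum_le_sum_of_subset_of_nonneg (Finset.filter_subset _ _) fun _ _ _ => by positivity
        _ ≤ 7 + 12 * Real.log N := by
            rw [← Finset.Icc_add_one_left_eq_Ioc]; exact Montgomery.sum_Icc_inv_totient_le N
  -- assemble with `log N ≤ log X`, `1 ≤ log X`
  have hK₁0 : 0 ≤ K₁ := by linarith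
  have hK₀0 : 0 ≤ K₀ := by linarith
  have hK₃0 : 0 ≤ K₃ := by linarith
  have h1 : 2 * K₁ / Real.log X * ∑ e ∈ (Ioc 0 N).filter Squarefree, rest e ≤
      8 * K₁ * (2 * K₀ * Real.exp 12 + 19 * K₃) := by
    calc 2 * K₁ / Real.log X * ∑ e ∈ (Ioc 0 N).filter Squarefree, rest e
        ≤ 2 * K₁ / Real.log X * (2 * (1 + Real.log (N : ℝ)) / Real.log X *
            (2 * K₀ * (Real.exp 12 * Real.log N) + K₃ * (7 + 12 * Real.log N))) :=
          mul_le_mul_of_nonneg_left hrestsum (by positivity)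
      _ ≤ 2 * K₁ / Real.log X * (2 * (2 * Real.log X) / Real.log X *
            (2 * K₀ * (Real.exp 12 * Real.log X) + K₃ * (19 * Real.log X))) := by
          refine mul_le_mul_of_nonneg_left ?_ (by positivity)
          refine mul_le_mul ?_ ?_ (by positivity) (by positivity)
          · exact div_le_div_of_nonneg_right (by linarith) hL.le
          · have := Real.exp_pos 12
            nlinarith [mul_le_mul_of_nonneg_left hlogNX (by positivity : 0 ≤ 2 * K₀ * Real.exp 12)]
      _ = 8 * K₁ * (2 * K₀ * Real.exp 12 + 19 * K₃) := by
          field_simp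
          ring
  have h2 : Real.log N * ∑ e ∈ Ioc 0 N, (Nat.totient e : ℝ) * y e ^ 2 ≤ 76 * K₁ ^ 2 := by
    calc Real.log N * ∑ e ∈ Ioc 0 N, (Nat.totient e : ℝ) * y e ^ 2
        ≤ Real.log X * (4 * K₁ ^ 2 * (7 + 12 * Real.log (N : ℝ)) / Real.log X ^ 2) :=
          mul_le_mul hlogNX hdiag (Finset.sum_nonneg fun e _ => by positivity) hL.le
      _ ≤ Real.log X * (4 * K₁ ^ 2 * (19 * Real.log X) / Real.log X ^ 2) := by
          refine mul_le_mul_of_nonneg_left (div_le_div_of_nonneg_right ?_ (by positivity)) hL.le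
          have hK : 0 ≤ K₁ ^ 2 := sq_nonneg _
          nlinarith
      _ = 76 * K₁ ^ 2 := by field_simp; ring
  linarith

end Literature.NumberTheory.LFunctions.PlateauMollifier
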